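import Literature.Probability.RandomPlanarGeometry.HexSAWBrickWallStripWidthOneSpeed
import Literature.Probability.RandomPlanarGeometry.HexSAWBrickWallStripFugacityWidthOneParityAmplitude
import Mathlib.Analysis.SpecialFunctions.Pow.Real
import Mathlib.Analysis.SpecialFunctions.Pow.Continuity
import Mathlib.Analysis.SpecialFunctions.Log.Deriv
import Mathlib.Analysis.Calculus.Deriv.Slope
import Mathlib.Tactic
import HarnessLib

/-!
# The speed of the adsorbing self-avoiding walk in the one-cell honeycomb strip:
# under the two-fugacity measure `P_{N,y,z} ∝ y^{bc(ω)} z^{tc(ω)}`, `|X(ω)|/N → v(y,z) = 1 − ρ(y,z)` in probability,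
# `ρ(y,z) = yz x₀⁴ / ( y(1 − z x₀²) + z(1 − y x₀²) + 3yz x₀⁴ )`, `x₀ = 1/μ_1(y,z)`

Topic `Literature/Probability/RandomPlanarGeometry` (continues `HexSAWBrickWallStripWidthOneSpeed.lean`: the counting automaton of
the one-cell brick-wall = honeycomb strip `S_1`, `WidthOne.nV / nB / defi`, the DEFICIT IDENTITY `|w| = |dX w| + nV w + 2·nB w`
(`length_eq_abs_dX_add`, `defi_eq`), `sum_acc_succ`, and the speed `v = 2(μ+1)/(2μ+3)` of the UNWEIGHTED walk;
`HexSAWBrickWallStripFugacityWidthOneSeries.lean`: the printed site weights `WidthOneYZ.swt / wprod / par` of the two-fugacity model,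
`pow_visits_eq_prod`, `prod_swt_traj`; `HexSAWBrickWallStripFugacitySymmetric.lean`: `HexBW.stripZ₂ 1 N y z = C_{1,N}(y,z)`;
`HexSAWBrickWallStripFugacityWidthOneSexticLaw.lean` / `…SexticLower.lean`: `μ_1(y,z)² (μ_1² − y)(μ_1² − z) = yz`, `y, z < μ_1²`;
`HexSAWBrickWallStripFugacityWidthOneParityAmplitude.lean`: Fekete `μ_1(y,z)^N ≤ K(y)K(z)·C_{1,N}(y,z)`).

SOURCES, as printed.  N. R. Beaton, M. Bousquet-Mélou, J. de Gier, H. Duminil-Copin, A. J. Guttmann, *The critical fugacity for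
surface adsorption of self-avoiding walks on the honeycomb lattice is `1+√2`*, Comm. Math. Phys. 326 (2014) = arXiv:1109.0358v5, §3.2
p. 10 (the strips `S_T`, "`C_{T,k}(y,z) = Σ_{|ω|=k} y^{bc(ω)} z^{tc(ω)}`", Proposition 6: `μ_T(y,z) = lim_k C_{T,k}(y,z)^{1/k}`) — the
objects; N. Madras, G. Slade, *The Self-Avoiding Walk* (1993), §1.1 eq. (1.1.5) (`⟨|ω(N)|²⟩ ∼ D N^{2ν}`), §8.5 pp. 278–279 (Klein 1980,
Alm–Janson 1990: `γ(R) = 1`, `ν(R) = 1` on one-dimensional lattices; S. E. Alm, S. Janson, Commun. Statist. Stochastic Models 6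
(1990) 169–212, not held here — cited as M–S §8.5 reports it); R. P. Stanley, *Enumerative Combinatorics* 1 (2nd ed.) §4.7
(transfer-matrix method with weights).  No speed or rung density of the adsorbing strip walk as a function of the wall fugacities is
printed in our holdings; this file proves the two-parameter law `v(y,z)` for ALL `y, z > 0` by the elementary route of the previous
file (deficit identity + a tilted Kraft potential on the counting automaton, now with the site weights `y`, `z`, a two-row critical
SURFACE, and potential constants valid for every `x > 0` — so the repulsive regime `μ_1(y,z) ≤ 1`, i.e. `y + z ≤ 1`
(`one_lt_stripMuY₂_one_iff`), is included); at `y = z = 1`, `v(1,1) = 2(μ+1)/(2μ+3)`.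

## Statements (namespaces `…SAW.HexBW.WidthOne` (§§1–5) and `…SAW.HexBW` (§§6–7); all PROVED, standard axioms)

§1 `par_add_one'`, `par_sub_one'`, `par_natCast`, **`epar`** (the column parity each automaton state expects; none in the corridor),
**`Cons p s c`** (consistency of a (state, parity) pair, incl. `rg1 A ⇒ p + A even`), `nextPar`, ★ `cons_step` (preserved by every
transition), `cons_start`.
§2 `wt` (site weight from row and parity), **`stepSumY`** (one tilted two-fugacity step: `t` per rung, `s` per back step, `y`/`z` per
odd-column arrival on the bottom/top row), **`WY`** (the tilted counts), `swt_eq_wt`, `wprod_cons`, `letterTerm`, ★ `sum_letterTerm₀/₁`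
(the first-letter decomposition sums to one tilted step), ★★ **`sum_acc_weightY : Σ_{w ∈ acc p g m} wprod(a,w)·t^{nV w}·s^{nB w} =
WY m g.s g.r (par a₀)`**.
§3 `wr, aY, bY`, **`DY = (1 − yx²)(1 − zx²) − t² yz x⁶`** (the critical surface of the rung-tilted two-fugacity forward phase),
`βY = max(1, 1/x)`, `COY, CEY` (corridor, by parity), `σY, SY, QY` (Cramer), `BY = β + Q, AY = xB, RY, UE0, UOY, UEY, GY, IEY, IOY,
STY`, **`ΦY`** (the potential on (state, row, parity)), `PotHyp` (`0 < x`, `y, z > 0`, `t, s ≥ 0`, `x² s² y ≤ 1`, `x² s² z ≤ 1`,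
`1 − yx² > 0`, `1 − zx² > 0`, `D > 0` — no `x < 1`), `row_facts`,
`potY_base`, ★ `potY_fwd` (the two Cramer inequalities), `potY_local`, `one_le_ΦY`, ★★ **`ΦY_step`** (supermartingale inequality
at every CONSISTENT state), `wprod_nonneg`, ★★★ **`sum_acc_weightY_mul_pow_le : (Σ_{acc} wprod·t^{nV}s^{nB})·x^m ≤ ΦY`** (THE
TWO-FUGACITY TILTED KRAFT INEQUALITY).
§4 ★ `sum_wprod_pow_defi_le`, ★ `sum_wprod_defi_ge_mul_rpow_le` / `sum_wprod_defi_le_mul_rpow_le` (weighted Chernoff, word level).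
§5 `cTY` (critical rung weight of `x`), `cGY`, `exp_cGY`, `hasDerivAt_cGY`, ★ `cGY_facts` (at `x₀ = μ⁻¹` of a sextic root: `T(x₀) = 1`,
`G(x₀) = 0`, `G'(x₀) = μ(1 − κ M)`, `M = 3 + yx₀²/(1−yx₀²) + zx₀²/(1−zx₀²)`), `cTY_lt_cTY` (monotone), `DY_eq`, `cTY_sq_mul`,
★★ **`exists_tiltY_gt`** / ★★ **`exists_tiltY_lt`** (for any `μ > 0`, `y, z < μ²`, `μ²(μ²−y)(μ²−z) = yz`: tilts `(t, x)` with all the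
potential hypotheses and `x t^κ μ > 1` exist on either side of `κ M = 1`).
§6 `wgt` (= `y^{bc} z^{tc}`, `stripZ₂_one_eq_sum_wgt`), `wgt_nonneg`, ★ `one_lt_stripMuY₂_one_iff` (`μ_1(y,z) > 1 ⟺ y + z > 1`), ★ `twoWallSpeed_one_one`
(`ρ(1,1) = 1/(2μ+3)`, `v(1,1) = stripOneSpeed`), **`twoWallM`**, ★ **`twoWallRho := 1/M`**, **`twoWallSpeed :=
1 − ρ`**, `twoWall_critical_facts`, ★★ **`twoWallRho_eq`** (the closed form above, from the sextic), ★ `sum_filter_wgt_eq` (weighted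
fibres = weighted word sums), `cons_start_site`, `startConst`, ★★ `sum_wgt_deficit_ge_le` / `sum_wgt_deficit_le_le` (Chernoff for
the weighted walks).
§7 `startConst_nonneg`, `weighted_fraction_le_geometric` (Fekete), ★★★ **`twoWall_deficit_ge_fraction_le`** /
★★★ **`twoWall_deficit_le_fraction_le`** (every `y, z > 0`: both tails of `N − |X(ω)|` around `ρ(y,z)N` have `P_{N,y,z}`-mass
`≤ C θ^N`, `θ < 1`), `twoWallSpeedDevPairs`, `twoWallSpeedDevPairs_subset`, ★★★ **`tendsto_twoWallSpeedDevFraction`**: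
`P_{N,y,z}(| |X(ω)|/N − v(y,z) | ≥ ε) → 0` for every `ε > 0` and EVERY `y, z > 0` — THE TWO-WALL SPEED LAW.
§8 (rung count alone, weights `s = 1`; walk level through the tree's `LadderPot.nV` and the bridge `ladderPot_nV_traj` of the previous
file) `PotHyp.to_one`, `sum_wprod_pow_nV_le`, `sum_wprod_nV_ge_mul_rpow_le` / `sum_wprod_nV_le_mul_rpow_le`, `sum_filter_wgt_rungs_eq`,
`startConst₁`, ★★ `sum_wgt_rungs_ge_le` / `sum_wgt_rungs_le_le`, ★★★ **`twoWall_rungs_ge_fraction_le` / `twoWall_rungs_le_fraction_le`**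
(both tails of `V(ω)` around `ρ(y,z)N` have `P_{N,y,z}`-mass `≤ C θ^N`), ★★★ **`tendsto_twoWallRungDevFraction`** (THE TWO-WALL RUNG
DENSITY: `V(ω)/N → ρ(y,z)` in `P_{N,y,z}`-probability), ★★ **`tendsto_twoWallBackStepFraction`** (back steps `o(N)`),
**`twoWallMeanAbsDisp`**, ★★★ **`tendsto_twoWallMeanAbsDisp_div : ⟨|X(ω)|⟩_{N,y,z}/N → v(y,z)`** (THE MEAN SPEED).
§9 **`twoWallMeanSqDisp`** (M–S (1.1.2) under `P_{N,y,z}`), ★★★ **`tendsto_twoWallMeanSqDisp_div_sq : ⟨‖ω(N)‖²⟩_{N,y,z}/N² → v(y,z)²`**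
(the amplitude `D` of (1.1.5) for the two-fugacity strip measure).

METHOD.  As in the unweighted file, with three additions: (i) the site weights depend on the column parity, which the automaton state
determines except in the corridor — `Cons`/`cons_step` carry the parity, and the Kraft induction runs over consistent configurations
only; (ii) the forward phase is a two-row system: with `a_r = 1 − w_r x²`, `b_r = t x³ w_r`, the constants `B_r = 1/x + Q_r` solve
`a_r Q_r − b_{1−r} Q_{1−r} = S_{1−r}` by Cramer with determinant `D = a₀a₁ − b₀b₁ > 0` (`potY_fwd`), the U-turn and corridor constants
alternate with the parity (only `x² s² w ≤ 1` is needed, so `x ≥ 1` is allowed); (iii) at `(t, x) = (1, μ_1⁻¹)` the surface is critical by the SEXTIC LAW of the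
tree and `d/dx log(x T(x)^κ μ_1) = μ_1(1 − κ M)`, `T(x)² yz x⁶ = (1−yx²)(1−zx²)`; Markov and Fekete give both tails.  Faces (HOME
`pub-sawmu-a-p5/g20/speed/kit/`): `tm_rho_yz.py` — weighted transfer matrix (DP over state × column parity × row, exact site weights,
four starting classes) to `N = 400`, Richardson: `E_{y,z}[V]/N` vs `ρ(y,z)` agree to `10⁻¹⁵` on `(1,1), (2,1), (1,2), (2,2), (3,½),
(½,½), (4,4), (1.5,0.7)`; `potential_check_yz.py` — the potential inequalities at consistent states on 961 random admissible
`(y,z,t,s,x)`: 0 violations, `ΦY ≥ 1`.  NOT CLAIMED: a CLT; the one-step increments `E[V]_{N+1} − E[V]_N` (which do NOT converge for `y ≠ z` — period two; only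
deviation probabilities and `1/N`-means are stated).  Faces for the all-`x` potential: `kit/potential_check_yz_allx.py`
(614 mixed + 2 040 samples with `x ≥ 1`: 0 violations).
-/

noncomputable section

open Filter Topology Finset Literature.Probability.LatticeModels Literature.Probability.Percolation SimpleGraph

namespace Literature.Probability.RandomPlanarGeometry.SAW.HexBW

namespace WidthOne

open LState WidthOneYZ

/-! ## §1 Column parity along the counting automaton -/

/-- `par (x + 1) = ¬ par x` (`WidthOneYZ.par`, `true` = odd column). [cite: Stanley2012EC1, §4.7 (lane plumbing)] -/
theorem par_add_one' (x : ℤ) : par (x + 1) = !par x := by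
  unfold par; by_cases h : x % 2 = 1 <;> simp [h] <;> omega

/-- `par (x − 1) = ¬ par x`. [cite: Stanley2012EC1, §4.7 (lane plumbing)] -/
theorem par_sub_one' (x : ℤ) : par (x + -1) = !par x := by
  unfold par; by_cases h : x % 2 = 1 <;> simp [h] <;> omega

/-- `par` of a natural number cast: `true` iff odd. [cite: Stanley2012EC1, §4.7 (lane plumbing)] -/
theorem par_natCast (n : ℕ) : par (n : ℤ) = !decide (Even n) := by
  unfold par
  by_cases h : Even n
  · simp [h]; obtain ⟨k, rfl⟩ := h; omega
  · simp [h]; rw [Nat.not_even_iff_odd] at h; obtain ⟨k, rfl⟩ := h; omega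

/-- **The column parity a state expects** (`true` = odd; `none` in the corridor, whose parity is not determined by the state):
`start ↦ p`, `ini k ↦ p+k+1`, `rg1 ↦ even`, `ut i ↦ p+i`, `up k ↦ p+k+1`, `fwd k ↦ k+1`, `rg2 ↦ even`.
[cite: Stanley2012EC1, §4.7 (transfer-matrix method)] -/
def epar (p : ℕ) : LState → Option Bool
  | start => some (!decide (Even p))
  | ini k => some (!decide (Even (p + k + 1)))
  | rg1 _ => some false
  | ut i => some (!decide (Even (p + i)))
  | up k => some (!decide (Even (p + k + 1)))
  | fwd k => some (!decide (Even (k + 1)))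
  | rg2 _ => some false
  | cor _ => none

/-- **Consistency of a (state, column parity) pair**: the parity is the expected one, and after the first rung the initial run has
the parity of the start column (`rg1 A ⇒ p + A` even). [cite: Stanley2012EC1, §4.7 (transfer-matrix method)] -/
def Cons (p : ℕ) (s : LState) (c : Bool) : Prop :=
  (∀ b, epar p s = some b → c = b) ∧ (∀ A, s = rg1 A → Even (p + A))

/-- The parity after a letter: flipped by a horizontal letter, kept by a rung. [cite: Stanley2012EC1, §4.7 (lane plumbing)] -/
def nextPar (c : Bool) (ℓ : Step) : Bool := if Step.dy ℓ = 0 then !c else c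

section cons

variable {p : ℕ} {h r h' r' : ℤ} {ℓ : Step} {s' : LState} {c : Bool}

/-- `Even (n+1)` decided is the negation of `Even n` decided. [folklore] -/
private theorem decide_even_add_one' (n : ℕ) : decide (Even (n + 1)) = !decide (Even n) := by
  by_cases hn : Even n
  · simp [hn, Nat.even_add_one]
  · simp [hn, Nat.even_add_one]

/-- ★ Consistency is preserved by every transition. [cite: Stanley2012EC1, §4.7 (transfer-matrix method)] -/
theorem cons_step {s : LState} (hc : Cons p s c) (hδ : δ p ⟨s, h, r⟩ ℓ = some ⟨s', h', r'⟩) :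
    Cons p s' (nextPar c ℓ) := by
  obtain ⟨hpar, hrg⟩ := hc
  rcases δ_eq_some hδ with ⟨hdy, -, -, -, ⟨-, -, hB⟩ | ⟨-, hF⟩⟩ | ⟨-, hdy, -, -, hR⟩
  · -- back step: parity flips
    have hnp : nextPar c ℓ = !c := by simp [nextPar, hdy]
    rw [hnp]
    rcases s with _ | k | (_ | j) | i | k | k | (_ | j) | j <;> simp only [backT, Option.some.injEq, reduceCtorEq] at hB <;>
      subst hB
    · -- rg1 (j+1) → ut j : parity even → odd = p + j odd
      have h1 : c = false := hpar false rfl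
      have h2 : Even (p + (j + 1)) := hrg (j + 1) rfl
      refine ⟨fun b hb => ?_, fun A hA => by simp at hA⟩
      simp only [epar, Option.some.injEq] at hb
      rw [← hb, h1]
      have : ¬ Even (p + j) := fun h3 => by rw [← add_assoc, Nat.even_add_one] at h2; exact h2 h3
      simp [this]
    · -- rg2 (j+1) → cor j
      exact ⟨fun b hb => by simp [epar] at hb, fun A hA => by simp at hA⟩
  · -- forward step: parity flips
    have hnp : nextPar c ℓ = !c := by simp [nextPar, hdy]
    rw [hnp]
    rcases s with _ | k | A | (_ | i) | k | k | k | (_ | j) <;>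
      simp only [fwdT, Option.some.injEq, reduceCtorEq] at hF <;> subst hF <;>
      refine ⟨fun b hb => ?_, fun A hA => by simp at hA⟩ <;>
      simp only [epar, Option.some.injEq, reduceCtorEq] at hb hpar <;>
      (rw [← hb, hpar _ rfl]; simp [← add_assoc, decide_even_add_one'])
  · -- rung: parity kept, and it is even
    have hdy0 : ¬ Step.dy ℓ = 0 := by omega
    have hnp : nextPar c ℓ = c := by simp [nextPar, hdy0]
    rw [hnp]
    rcases s with _ | k | A | i | k | k | k | j <;> simp only [rungT, reduceCtorEq] at hR
    · split_ifs at hR with hp; simp only [Option.some.injEq] at hR; subst hR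
      refine ⟨fun b hb => ?_, fun A hA => ?_⟩
      · simp only [epar, Option.some.injEq] at hb hpar; rw [← hb, hpar _ rfl]; simp [hp]
      · simp only [LState.rg1.injEq] at hA; subst hA; simpa using hp
    · split_ifs at hR with hp; simp only [Option.some.injEq] at hR; subst hR
      refine ⟨fun b hb => ?_, fun A hA => ?_⟩
      · simp only [epar, Option.some.injEq] at hb hpar; rw [← hb, hpar _ rfl]; simp [hp]
      · simp only [LState.rg1.injEq] at hA; subst hA; simpa [add_assoc] using hp
    · split_ifs at hR with hp; simp only [Option.some.injEq] at hR; subst hR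
      refine ⟨fun b hb => ?_, fun A hA => by simp at hA⟩
      simp only [epar, Option.some.injEq] at hb hpar; rw [← hb, hpar _ rfl]; simp [hp]
    · split_ifs at hR with hp; simp only [Option.some.injEq] at hR; subst hR
      refine ⟨fun b hb => ?_, fun A hA => by simp at hA⟩
      simp only [epar, Option.some.injEq] at hb hpar; rw [← hb, hpar _ rfl]; simp [hp]

/-- The starting configuration is consistent with the parity of the start column. [cite: Stanley2012EC1, §4.7 (lane plumbing)] -/
theorem cons_start (p : ℕ) : Cons p start (!decide (Even p)) :=
  ⟨fun b hb => by simp only [epar, Option.some.injEq] at hb; exact hb, fun A hA => by simp at hA⟩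

end cons

/-! ## §2 The two-fugacity tilted counts (`y`/`z` per odd-column site on the bottom/top row, `t` per rung, `s` per back step) -/

/-- The weight of a site from its row `r ∈ {0,1}` and column parity `c` (`true` = odd): `y` / `z` at odd columns of the bottom / top row,
`1` at even columns. [cite: BeatonBousquetMelouDeGierDuminilCopinGuttmann2014, §3.2 (arXiv v5 p. 10: y^{bc(ω)} z^{tc(ω)})] -/
def wt (y z : ℝ) (r : ℤ) (c : Bool) : ℝ := if c = true then (if r = 0 then y else z) else 1

/-- **One tilted two-fugacity step** on (state, row, column parity): horizontal successors land on the other parity of the same row,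
rung successors on the same (even) column of the other row. [cite: Stanley2012EC1, §4.7 (transfer-matrix method with weights)] -/
def stepSumY (y z t s : ℝ) (p : ℕ) (f : LState → ℤ → Bool → ℝ) (st : LState) (r : ℤ) (c : Bool) : ℝ :=
  match st with
  | start => 2 * (wt y z r (!c) * f (ini 0) r (!c)) + (if Even p then t * (wt y z (1 - r) c * f (rg1 0) (1 - r) c) else 0)
  | ini k => wt y z r (!c) * f (ini (k + 1)) r (!c) +
      (if Even (p + k + 1) then t * (wt y z (1 - r) c * f (rg1 (k + 1)) (1 - r) c) else 0)
  | rg1 0 => 2 * (wt y z r (!c) * f (fwd 0) r (!c))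
  | rg1 (j + 1) => wt y z r (!c) * f (fwd 0) r (!c) + s * (wt y z r (!c) * f (ut j) r (!c))
  | ut 0 => wt y z r (!c) * f (up 0) r (!c)
  | ut (i + 1) => s * (wt y z r (!c) * f (ut i) r (!c))
  | up k => wt y z r (!c) * f (up (k + 1)) r (!c) +
      (if Even (p + k + 1) then t * (wt y z (1 - r) c * f (rg2 k) (1 - r) c) else 0)
  | fwd k => wt y z r (!c) * f (fwd (k + 1)) r (!c) + (if Even (k + 1) then t * (wt y z (1 - r) c * f (rg2 k) (1 - r) c) else 0)
  | rg2 0 => wt y z r (!c) * f (fwd 0) r (!c)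
  | rg2 (j + 1) => wt y z r (!c) * f (fwd 0) r (!c) + s * (wt y z r (!c) * f (cor j) r (!c))
  | cor 0 => 0
  | cor (j + 1) => s * (wt y z r (!c) * f (cor j) r (!c))

/-- **The tilted two-fugacity counts** by the recursion. [cite: Stanley2012EC1, §4.7 (transfer-matrix method with weights)] -/
def WY (y z t s : ℝ) (p : ℕ) : ℕ → LState → ℤ → Bool → ℝ
  | 0 => fun _ _ _ => 1
  | m + 1 => fun st r c => stepSumY y z t s p (WY y z t s p m) st r c

/-- `WY … 0 = 1`. [cite: Stanley2012EC1, §4.7 (lane plumbing)] -/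
@[simp] theorem WY_zero (y z t s : ℝ) (p : ℕ) (st : LState) (r : ℤ) (c : Bool) : WY y z t s p 0 st r c = 1 := rfl

/-- `WY … (m+1) = stepSumY … (WY … m)`. [cite: Stanley2012EC1, §4.7 (lane plumbing)] -/
theorem WY_succ (y z t s : ℝ) (p : ℕ) (m : ℕ) (st : LState) (r : ℤ) (c : Bool) :
    WY y z t s p (m + 1) st r c = stepSumY y z t s p (WY y z t s p m) st r c := rfl

section weights

variable (y z t s : ℝ)

/-- The site weight of the tree (`WidthOneYZ.swt`) from row and parity. [cite: BeatonBousquetMelouDeGierDuminilCopinGuttmann2014, §3.2 (arXiv v5 p. 10)] -/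
theorem swt_eq_wt (v : Site 2) (hv : v 1 = 0 ∨ v 1 = 1) : swt y z v = wt y z (v 1) (par (v 0)) := by
  unfold swt wt wρ
  rcases hv with h | h <;> by_cases hx : par (v 0) = true <;> simp [h, hx]

/-- `wprod` of a cons. [cite: BeatonBousquetMelouDeGierDuminilCopinGuttmann2014, §3.2 (lane plumbing)] -/
theorem wprod_cons (a : Site 2) (ℓ : Step) (w : List Step) :
    wprod y z a (ℓ :: w) = swt y z (a + Step.vec ℓ) * wprod y z (a + Step.vec ℓ) w := rfl

/-- `Option.elim` through an `if`. [folklore] -/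
private theorem elim_ite'' {α β : Type*} (c : Prop) [Decidable c] (x : α) (b : β) (f : α → β) :
    (if c then some x else none).elim b f = if c then f x else b := by
  split_ifs <;> rfl

/-- The contribution of a first letter `ℓ` to the tilted two-fugacity word sum (site weight of the arrival site, the letter's tilt, and
the tilted count of the successor). [cite: Stanley2012EC1, §4.7 (lane plumbing)] -/
def letterTerm (p : ℕ) (F : LState → ℤ → Bool → ℝ) (g : GState) (a : Site 2) (ℓ : Step) : ℝ :=
  (δ p g ℓ).elim 0 fun g' => swt y z (a + Step.vec ℓ) * (t ^ (if Step.dy ℓ = 0 then 0 else 1) *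
    s ^ (if isBack g.s g'.s then 1 else 0)) * F g'.s g'.r (par ((a + Step.vec ℓ) 0))

/-- **The first-letter decomposition sums to one tilted step**, bottom row: `Σ_ℓ letterTerm F = stepSumY F` at a site of row `0`. [cite: Stanley2012EC1, §4.7 (transfer-matrix method with weights)] -/
theorem sum_letterTerm₀ (p : ℕ) (F : LState → ℤ → Bool → ℝ) (st : LState) (hh : ℤ) (hg : HOk ⟨st, hh, 0⟩) (a : Site 2)
    (ha : a 1 = 0) : ∑ ℓ : Step, letterTerm y z t s p F ⟨st, hh, 0⟩ a ℓ = stepSumY y z t s p F st 0 (par (a 0)) := by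
  have hw0 : swt y z (a + Step.vec 0) = wt y z 0 (!par (a 0)) := by
    rw [swt_eq_wt y z _ (by simp [Step.dy, ha])]; simp [Step.dx, Step.dy, ha, par_add_one']
  have hw2 : swt y z (a + Step.vec 2) = wt y z 0 (!par (a 0)) := by
    rw [swt_eq_wt y z _ (by simp [Step.dy, ha])]; simp [Step.dx, Step.dy, ha, par_sub_one']
  have hw1 : swt y z (a + Step.vec 1) = wt y z 1 (par (a 0)) := by
    rw [swt_eq_wt y z _ (by simp [Step.dy, ha])]; simp [Step.dx, Step.dy, ha]
  have hp0' : par (a 0 + 1) = !par (a 0) := par_add_one' _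
  have hp2' : par (a 0 + -1) = !par (a 0) := par_sub_one' _
  rw [Fin.sum_univ_four]
  simp only [letterTerm]
  rw [hw0, hw1, hw2]
  set c := par (a 0)
  rcases st with _ | k | (_ | j) | (_ | i) | k | k | (_ | j) | (_ | j) <;>
  simp only [HOk] at hg <;>
  rcases hg with rfl | rfl | rfl <;>
  simp [δ, fwdT, backT, rungT, Step.dx, Step.dy, stepSumY, isBack, two_mul, apply_ite, elim_ite'', hp0', hp2'] <;>
  (try split_ifs) <;> (try intro _hc) <;>
  first | (exfalso; simp only [Nat.even_iff] at *; omega) | ring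

/-- **The first-letter decomposition sums to one tilted step**, top row. [cite: Stanley2012EC1, §4.7 (transfer-matrix method with weights)] -/
theorem sum_letterTerm₁ (p : ℕ) (F : LState → ℤ → Bool → ℝ) (st : LState) (hh : ℤ) (hg : HOk ⟨st, hh, 1⟩) (a : Site 2)
    (ha : a 1 = 1) : ∑ ℓ : Step, letterTerm y z t s p F ⟨st, hh, 1⟩ a ℓ = stepSumY y z t s p F st 1 (par (a 0)) := by
  have hw0 : swt y z (a + Step.vec 0) = wt y z 1 (!par (a 0)) := by
    rw [swt_eq_wt y z _ (by simp [Step.dy, ha])]; simp [Step.dx, Step.dy, ha, par_add_one']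
  have hw2 : swt y z (a + Step.vec 2) = wt y z 1 (!par (a 0)) := by
    rw [swt_eq_wt y z _ (by simp [Step.dy, ha])]; simp [Step.dx, Step.dy, ha, par_sub_one']
  have hw3 : swt y z (a + Step.vec 3) = wt y z 0 (par (a 0)) := by
    rw [swt_eq_wt y z _ (by simp [Step.dy, ha])]; simp [Step.dx, Step.dy, ha]
  have hp0' : par (a 0 + 1) = !par (a 0) := par_add_one' _
  have hp2' : par (a 0 + -1) = !par (a 0) := par_sub_one' _
  rw [Fin.sum_univ_four]
  simp only [letterTerm]
  rw [hw0, hw3, hw2]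
  set c := par (a 0)
  rcases st with _ | k | (_ | j) | (_ | i) | k | k | (_ | j) | (_ | j) <;>
  simp only [HOk] at hg <;>
  rcases hg with rfl | rfl | rfl <;>
  simp [δ, fwdT, backT, rungT, Step.dx, Step.dy, stepSumY, isBack, two_mul, apply_ite, elim_ite'', hp0', hp2'] <;>
  (try split_ifs) <;> (try intro _hc) <;>
  first | (exfalso; simp only [Nat.even_iff] at *; omega) | ring

/-- ★ **The tilted two-fugacity word sums are the tilted counts**: from a configuration `g` at a site `a` of row `g.r`,
`Σ_{w ∈ acc p g m} wprod(a,w)·t^{nV w}·s^{nB w} = WY … m g.s g.r (par a₀)`. [cite: Stanley2012EC1, §4.7 (transfer-matrix method with weights); BeatonBousquetMelouDeGierDuminilCopinGuttmann2014, §3.2] -/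
theorem sum_acc_weightY (p : ℕ) (m : ℕ) (g : GState) (hg : HOk g) (hr : g.r = 0 ∨ g.r = 1) (a : Site 2) (ha : a 1 = g.r) :
    ∑ w ∈ acc p g m, wprod y z a w * (t ^ nV w * s ^ nB p g w) = WY y z t s p m g.s g.r (par (a 0)) := by
  induction m generalizing g a with
  | zero =>
    have hacc : acc p g 0 = {[]} := by
      ext w; simp only [acc, Finset.mem_filter, mem_words, List.length_eq_zero_iff, Finset.mem_singleton]
      constructor
      · exact fun h => h.1
      · rintro rfl; exact ⟨rfl, by simp⟩
    rw [hacc, Finset.sum_singleton]; simp [wprod]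
  | succ m ih =>
    rw [sum_acc_succ, WY_succ]
    have key : ∀ ℓ : Step, ((δ p g ℓ).elim 0 fun g' => ∑ w ∈ acc p g' m, wprod y z a (ℓ :: w) * (t ^ nV (ℓ :: w) * s ^ nB p g (ℓ :: w))) =
        letterTerm y z t s p (WY y z t s p m) g a ℓ := by
      intro ℓ
      unfold letterTerm
      cases hδ : δ p g ℓ with
      | none => rfl
      | some g' =>
        have hstep := δ_eq_some (s := g.s) (h := g.h) (r := g.r) (s' := g'.s) (h' := g'.h) (r' := g'.r) hδ
        have hr' : g'.r = 0 ∨ g'.r = 1 := by rcases hstep with ⟨-, -, -, h4, -⟩ | ⟨-, -, -, h4, -⟩ <;> omega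
        have hrow : (a + Step.vec ℓ) 1 = g'.r := by
          simp only [Pi.add_apply, Step.vec_apply_one]
          rcases hstep with ⟨hdy, -, -, h4, -⟩ | ⟨-, hdy, -, h4, -⟩ <;> rw [hdy, h4, ha] <;> ring
        have hg' : HOk g' := by
          obtain ⟨s₀, h₀, r₀⟩ := g; obtain ⟨s₁, h₁, r₁⟩ := g'
          simp only at hstep hg
          rcases hstep with ⟨-, hdx, hh1, -, ⟨-, -, hB⟩ | ⟨-, hF⟩⟩ | ⟨-, -, hh1, -, hR⟩
          · rcases s₀ with _ | k | (_ | j) | i | k | k | (_ | j) | j <;>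
              simp only [backT, Option.some.injEq, reduceCtorEq] at hB <;> subst hB <;> simp only [HOk] <;> omega
          · rcases s₀ with _ | k | A | (_ | i) | k | k | k | (_ | j) <;>
              simp only [fwdT, Option.some.injEq, reduceCtorEq] at hF <;> subst hF <;> simp only [HOk] <;> omega
          · rcases s₀ with _ | k | A | i | k | k | k | j <;> simp only [rungT, reduceCtorEq] at hR <;> split_ifs at hR <;>
              simp only [Option.some.injEq] at hR <;> subst hR <;> simp only [HOk] at hg ⊢ <;> omega
        simp only [Option.elim, wprod_cons, nV_cons, nB_cons_of_some p hδ, pow_add]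
        rw [← ih g' hg' hr' (a + Step.vec ℓ) hrow]
        simp only [Finset.mul_sum]
        exact Finset.sum_congr rfl fun w _ => by ring
    rw [Finset.sum_congr rfl fun ℓ _ => key ℓ]
    obtain ⟨st, hh, r⟩ := g
    simp only at hr ha hg ⊢
    rcases hr with rfl | rfl
    · exact sum_letterTerm₀ y z t s p _ st hh hg a ha
    · exact sum_letterTerm₁ y z t s p _ st hh hg a ha

end weights

/-! ## §3 The two-fugacity tilted potential below the critical surface `(1 − yx²)(1 − zx²) = t² yz x⁶` -/

section potential2

/-- Odd-site weight of row `r`: `y` on the bottom row, `z` on the top row. [cite: BeatonBousquetMelouDeGierDuminilCopinGuttmann2014, §3.2 (arXiv v5 p. 10)] -/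
def wr (y z : ℝ) (r : ℤ) : ℝ := if r = 0 then y else z

variable (y z t s x : ℝ)

/-- `a_r = 1 − w_r x²`. [cite: Stanley2012EC1, §4.7 (lane plumbing)] -/
def aY (r : ℤ) : ℝ := 1 - wr y z r * x ^ 2
/-- `b_r = t x³ w_r`. [cite: Stanley2012EC1, §4.7 (lane plumbing)] -/
def bY (r : ℤ) : ℝ := t * x ^ 3 * wr y z r
/-- `D₂ = a₀a₁ − b₀b₁ = (1 − yx²)(1 − zx²) − t² yz x⁶`: positive exactly below the critical surface of the rung-tilted two-fugacity forward
phase. [cite: Stanley2012EC1, §4.7 (transfer-matrix method with weights); BeatonBousquetMelouDeGierDuminilCopinGuttmann2014, §3.2 Proposition 6] -/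
def DY : ℝ := aY y z x 0 * aY y z x 1 - bY y z t x 0 * bY y z t x 1
/-- `β = max(1, 1/x)`: the floor of the forward potentials (so that `Φ ≥ 1` for every `x > 0`). [cite: Stanley2012EC1, §4.7 (lane plumbing)] -/
def βY : ℝ := max 1 (1 / x)
/-- Corridor potential at an ODD column (the next back step lands on an even site, weight `1`): `max(1, x s)`. [cite: Stanley2012EC1, §4.7 (lane plumbing)] -/
def COY : ℝ := max 1 (x * s)
/-- Corridor potential at an EVEN column of row `r` (the next back step lands on an odd site, weight `w_r`): `max(1, x s w_r · CO)`.
[cite: Stanley2012EC1, §4.7 (lane plumbing)] -/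
def CEY (r : ℤ) : ℝ := max 1 (x * s * wr y z r * COY s x)
/-- Source `σ_r = t x (x w_r s CO + 1)`. [cite: Stanley2012EC1, §4.7 (lane plumbing)] -/
def σY (r : ℤ) : ℝ := t * x * (x * wr y z r * s * COY s x + 1)
/-- Adjusted source `S_r = σ_r + b_r β`. [cite: Stanley2012EC1, §4.7 (lane plumbing)] -/
def SY (r : ℤ) : ℝ := σY y z t s x r + bY y z t x r * βY x
/-- `Q_r` (Cramer): `a_r Q_r − b_{1−r} Q_{1−r} = S_{1−r}`. [cite: Stanley2012EC1, §4.7 (lane plumbing)] -/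
def QY (r : ℤ) : ℝ := (aY y z x (1 - r) * SY y z t s x (1 - r) + bY y z t x (1 - r) * SY y z t s x r) / DY y z t x
/-- Forward potential at an even column of row `r`: `B_r = β + Q_r`. [cite: Stanley2012EC1, §4.7 (lane plumbing)] -/
def BY (r : ℤ) : ℝ := βY x + QY y z t s x r
/-- Forward potential at an odd column: `A_r = x B_r`. [cite: Stanley2012EC1, §4.7 (lane plumbing)] -/
def AY (r : ℤ) : ℝ := x * BY y z t s x r
/-- Potential just after a later rung: `R_r = x w_r (A_r + s CO) + 1`. [cite: Stanley2012EC1, §4.7 (lane plumbing)] -/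
def RY (r : ℤ) : ℝ := x * wr y z r * (AY y z t s x r + s * COY s x) + 1
/-- U-turn potential, auxiliary: `max(x w_r A_r, 1)`. [cite: Stanley2012EC1, §4.7 (lane plumbing)] -/
def UE0 (r : ℤ) : ℝ := max (x * wr y z r * AY y z t s x r) 1
/-- U-turn potential at an ODD column: `max(x B_r, 1, x s · UE0_r)`. [cite: Stanley2012EC1, §4.7 (lane plumbing)] -/
def UOY (r : ℤ) : ℝ := max (x * BY y z t s x r) (max 1 (x * s * UE0 y z t s x r))
/-- U-turn potential at an EVEN column: `max(UE0_r, x s w_r UO_r)`. [cite: Stanley2012EC1, §4.7 (lane plumbing)] -/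
def UEY (r : ℤ) : ℝ := max (UE0 y z t s x r) (x * s * wr y z r * UOY y z t s x r)
/-- Potential just after the first rung: `G_r = x w_r (2A_r + s UO_r) + 1`. [cite: Stanley2012EC1, §4.7 (lane plumbing)] -/
def GY (r : ℤ) : ℝ := x * wr y z r * (2 * AY y z t s x r + s * UOY y z t s x r) + 1
/-- Initial-run potential at an even column: `I_r = β + x t G_{1−r}/a_r`. [cite: Stanley2012EC1, §4.7 (lane plumbing)] -/
def IEY (r : ℤ) : ℝ := βY x + x * t * GY y z t s x (1 - r) / aY y z x r
/-- Initial-run potential at an odd column: `x I_r`. [cite: Stanley2012EC1, §4.7 (lane plumbing)] -/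
def IOY (r : ℤ) : ℝ := x * IEY y z t s x r
/-- Start potential. [cite: Stanley2012EC1, §4.7 (lane plumbing)] -/
def STY (r : ℤ) : ℝ := x * (2 * max (wr y z r) 1 * max (IEY y z t s x r) (IOY y z t s x r) + t * GY y z t s x (1 - r))

/-- **The two-fugacity potential `ΦY`** on (state, row, column parity). [cite: Stanley2012EC1, §4.7 (transfer-matrix method with weights)] -/
def ΦY (st : LState) (r : ℤ) (c : Bool) : ℝ :=
  match st with
  | start => STY y z t s x r
  | ini _ => if c = true then IOY y z t s x r else IEY y z t s x r
  | rg1 _ => GY y z t s x r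
  | ut _ => if c = true then UOY y z t s x r else UEY y z t s x r
  | up _ => if c = true then AY y z t s x r else BY y z t s x r
  | fwd _ => if c = true then AY y z t s x r else BY y z t s x r
  | rg2 _ => RY y z t s x r
  | cor _ => if c = true then COY s x else CEY y z s x r

/-- The standing hypotheses of the potential: `0 < x`, `y, z > 0`, `t, s ≥ 0`, `x² s² y ≤ 1`, `x² s² z ≤ 1`, `1 − yx² > 0`, `1 − zx² > 0`,
`D > 0` (no `x < 1`: the regime `μ_1(y,z) ≤ 1` is covered). [cite: Stanley2012EC1, §4.7 (lane plumbing)] -/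
structure PotHyp : Prop where
  /-- `0 < x` -/
  hx0 : 0 < x
  /-- `0 < y` -/
  hy : 0 < y
  /-- `0 < z` -/
  hz : 0 < z
  /-- `0 ≤ t` -/
  ht : 0 ≤ t
  /-- `0 ≤ s` -/
  hs : 0 ≤ s
  /-- `x² s² y ≤ 1` (two back steps on the bottom row) -/
  hssy : x ^ 2 * s ^ 2 * y ≤ 1
  /-- `x² s² z ≤ 1` (two back steps on the top row) -/
  hssz : x ^ 2 * s ^ 2 * z ≤ 1
  /-- `1 − yx² > 0` -/
  hay : 0 < 1 - y * x ^ 2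
  /-- `1 − zx² > 0` -/
  haz : 0 < 1 - z * x ^ 2
  /-- below the critical surface: `D > 0` -/
  hD : 0 < DY y z t x

variable {y z t s x}

/-- Row data: `w_r > 0`, `a_r > 0`, `x² s² w_r ≤ 1`, and `D₂ = a_r a_{1−r} − b_r b_{1−r}`. [cite: Stanley2012EC1, §4.7 (lane plumbing)] -/
theorem row_facts (H : PotHyp y z t s x) {r : ℤ} (hr : r = 0 ∨ r = 1) :
    0 < wr y z r ∧ 0 < aY y z x r ∧ x ^ 2 * s ^ 2 * wr y z r ≤ 1 ∧ 0 < wr y z (1 - r) ∧ 0 < aY y z x (1 - r) ∧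
      DY y z t x = aY y z x r * aY y z x (1 - r) - bY y z t x r * bY y z t x (1 - r) ∧ (1 - (1 - r) = r) := by
  rcases hr with rfl | rfl
  · refine ⟨by simpa [wr] using H.hy, by simpa [aY, wr] using H.hay, by simpa [wr] using H.hssy, by simpa [wr] using H.hz,
      by simpa [aY, wr] using H.haz, by simp [DY], by norm_num⟩
  · refine ⟨by simpa [wr] using H.hz, by simpa [aY, wr] using H.haz, by simpa [wr] using H.hssz, by simpa [wr] using H.hy,
      by simpa [aY, wr] using H.hay, by simp [DY]; ring, by norm_num⟩

/-- The constants of one row: positivity and `≥ 1`. [cite: Stanley2012EC1, §4.7 (lane plumbing)] -/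
theorem potY_base (H : PotHyp y z t s x) {r : ℤ} (hr : r = 0 ∨ r = 1) :
    0 ≤ QY y z t s x r ∧ 1 ≤ βY x ∧ 1 ≤ x * βY x ∧ 1 ≤ AY y z t s x r ∧ x * BY y z t s x r = AY y z t s x r ∧
    1 ≤ BY y z t s x r ∧ 1 ≤ COY s x ∧ 1 ≤ CEY y z s x r ∧ 1 ≤ RY y z t s x r ∧ 1 ≤ GY y z t s x r ∧ 0 ≤ GY y z t s x (1 - r) ∧
    1 ≤ UE0 y z t s x r ∧ 1 ≤ UOY y z t s x r ∧ 1 ≤ UEY y z t s x r ∧ 1 ≤ IEY y z t s x r ∧ 1 ≤ IOY y z t s x r ∧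
    x * IEY y z t s x r = IOY y z t s x r ∧ 1 ≤ STY y z t s x r := by
  have H' := H
  obtain ⟨hx0, hy, hz, ht, hs, -, -, -, -, hD⟩ := H'
  obtain ⟨hw, ha, hssw, hw', ha', hDr, h11⟩ := row_facts H hr
  have hβ1 : 1 ≤ βY x := le_max_left _ _
  have hβx : 1 ≤ x * βY x := by
    have : 1 / x ≤ βY x := le_max_right _ _
    calc (1 : ℝ) = x * (1 / x) := by field_simp
      _ ≤ x * βY x := mul_le_mul_of_nonneg_left this hx0.le
  have hCO1 : 1 ≤ COY s x := le_max_left _ _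
  have hCE1 : 1 ≤ CEY y z s x r := le_max_left _ _
  have hσ : 0 ≤ σY y z t s x r := by unfold σY; have := hCO1; positivity
  have hσ' : 0 ≤ σY y z t s x (1 - r) := by unfold σY; have := hCO1; positivity
  have hb : 0 ≤ bY y z t x r := by unfold bY; positivity
  have hb' : 0 ≤ bY y z t x (1 - r) := by unfold bY; positivity
  have hβ0 : 0 ≤ βY x := zero_le_one.trans hβ1
  have hS : 0 ≤ SY y z t s x r := by unfold SY; positivity
  have hS' : 0 ≤ SY y z t s x (1 - r) := by unfold SY; positivity
  have hQ : 0 ≤ QY y z t s x r := by unfold QY; positivity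
  have hQ' : 0 ≤ QY y z t s x (1 - r) := by unfold QY; rw [h11]; positivity
  have hab : x * BY y z t s x r = AY y z t s x r := rfl
  have hB1 : 1 ≤ BY y z t s x r := by unfold BY; linarith
  have hB1' : 1 ≤ BY y z t s x (1 - r) := by unfold BY; linarith
  have hA1 : 1 ≤ AY y z t s x r := by
    unfold AY BY; nlinarith [mul_nonneg hx0.le hQ]
  have hA0 : 0 ≤ AY y z t s x r := zero_le_one.trans hA1
  have hA0' : 0 ≤ AY y z t s x (1 - r) := by unfold AY; positivity
  have hR1 : 1 ≤ RY y z t s x r := by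
    have h0 : 0 ≤ x * wr y z r * (AY y z t s x r + s * COY s x) := by have := hCO1; positivity
    unfold RY; linarith
  have hUE01 : 1 ≤ UE0 y z t s x r := le_max_right _ _
  have hUO1 : 1 ≤ UOY y z t s x r := le_max_of_le_right (le_max_left _ _)
  have hUO0 : 0 ≤ UOY y z t s x r := zero_le_one.trans hUO1
  have hUO0' : 0 ≤ UOY y z t s x (1 - r) :=
    zero_le_one.trans (le_max_of_le_right (le_max_left _ _))
  have hUE1 : 1 ≤ UEY y z t s x r := le_max_of_le_left hUE01
  have hG1 : 1 ≤ GY y z t s x r := by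
    have h0 : 0 ≤ x * wr y z r * (2 * AY y z t s x r + s * UOY y z t s x r) := by positivity
    unfold GY; linarith
  have hG0' : 0 ≤ GY y z t s x (1 - r) := by unfold GY; positivity
  have hT : 0 ≤ x * t * GY y z t s x (1 - r) / aY y z x r := by positivity
  have hIE1 : 1 ≤ IEY y z t s x r := by unfold IEY; linarith
  have hIO : x * IEY y z t s x r = IOY y z t s x r := rfl
  have hIO1 : 1 ≤ IOY y z t s x r := by
    rw [← hIO]; unfold IEY; rw [mul_add]
    have : 0 ≤ x * (x * t * GY y z t s x (1 - r) / aY y z x r) := by positivity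
    linarith
  have hIE0 : 0 ≤ IEY y z t s x r := zero_le_one.trans hIE1
  have hmax1 : 1 ≤ max (wr y z r) 1 := le_max_right _ _
  have hST1 : 1 ≤ STY y z t s x r := by
    unfold STY
    have h2 : 0 ≤ t * GY y z t s x (1 - r) := mul_nonneg ht hG0'
    have h3 : 1 ≤ x * max (IEY y z t s x r) (IOY y z t s x r) :=
      le_trans (by rw [hIO]; exact hIO1) (mul_le_mul_of_nonneg_left (le_max_left _ _) hx0.le)
    have h4 : x * max (IEY y z t s x r) (IOY y z t s x r) ≤ x * (max (wr y z r) 1 * max (IEY y z t s x r) (IOY y z t s x r)) := by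
      apply mul_le_mul_of_nonneg_left _ hx0.le
      have : 0 ≤ max (IEY y z t s x r) (IOY y z t s x r) := le_trans hIE0 (le_max_left _ _)
      nlinarith only [hmax1, this]
    nlinarith only [h2, h3, h4, hx0]
  exact ⟨hQ, hβ1, hβx, hA1, hab, hB1, hCO1, hCE1, hR1, hG1, hG0', hUE01, hUO1, hUE1, hIE1, hIO1, hIO, hST1⟩

/-- The two forward inequalities (Cramer below the critical surface): `x(w_r A_r + t R_{1−r}) ≤ B_r` and `x(w_r·xI_r + t G_{1−r}) ≤ I_r`.
[cite: Stanley2012EC1, §4.7 (transfer-matrix method with weights)] -/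
theorem potY_fwd (H : PotHyp y z t s x) {r : ℤ} (hr : r = 0 ∨ r = 1) :
    x * (wr y z r * AY y z t s x r + t * RY y z t s x (1 - r)) ≤ BY y z t s x r ∧
    x * (wr y z r * IOY y z t s x r + t * GY y z t s x (1 - r)) ≤ IEY y z t s x r := by
  have H' := H
  obtain ⟨hx0, hy, hz, ht, hs, -, -, -, -, hD⟩ := H'
  obtain ⟨hw, ha, hssw, hw', ha', hDr, h11⟩ := row_facts H hr
  have hβ0 : 0 ≤ βY x := zero_le_one.trans (le_max_left _ _)
  have hCramer : aY y z x r * QY y z t s x r - bY y z t x (1 - r) * QY y z t s x (1 - r) = SY y z t s x (1 - r) := by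
    unfold QY; rw [h11]; field_simp; rw [hDr]; ring
  constructor
  · have key : BY y z t s x r - x * (wr y z r * AY y z t s x r + t * RY y z t s x (1 - r)) = aY y z x r * βY x := by
      simp only [BY, RY, AY, aY, bY, SY, σY] at hCramer ⊢
      linear_combination hCramer
    nlinarith [key, mul_nonneg ha.le hβ0]
  · have ha2 : (1 - wr y z r * x ^ 2) ≠ 0 := by unfold aY at ha; exact ha.ne'
    have e : x * t * GY y z t s x (1 - r) / (1 - wr y z r * x ^ 2) * (1 - wr y z r * x ^ 2) =
        x * t * GY y z t s x (1 - r) := div_mul_cancel₀ _ ha2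
    have key : IEY y z t s x r - x * (wr y z r * IOY y z t s x r + t * GY y z t s x (1 - r)) = aY y z x r * βY x := by
      simp only [IOY, IEY, aY] at e ⊢
      linear_combination e
    nlinarith [key, mul_nonneg ha.le hβ0]

/-- The remaining local inequalities of the potential. [cite: Stanley2012EC1, §4.7 (lane plumbing)] -/
theorem potY_local (H : PotHyp y z t s x) {r : ℤ} (hr : r = 0 ∨ r = 1) :
    x * (2 * (wr y z r * AY y z t s x r)) ≤ GY y z t s x r ∧
    x * (wr y z r * AY y z t s x r + s * (wr y z r * UOY y z t s x r)) ≤ GY y z t s x r ∧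
    x * BY y z t s x r ≤ UOY y z t s x r ∧ x * (wr y z r * AY y z t s x r) ≤ UEY y z t s x r ∧
    x * (s * UEY y z t s x r) ≤ UOY y z t s x r ∧ x * (s * (wr y z r * UOY y z t s x r)) ≤ UEY y z t s x r ∧
    x * (wr y z r * AY y z t s x r) ≤ RY y z t s x r ∧ x * (wr y z r * AY y z t s x r + s * (wr y z r * COY s x)) ≤ RY y z t s x r ∧
    x * (s * CEY y z s x r) ≤ COY s x ∧ x * (s * (wr y z r * COY s x)) ≤ CEY y z s x r ∧
    x * (2 * (wr y z r * IOY y z t s x r) + t * GY y z t s x (1 - r)) ≤ STY y z t s x r ∧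
    x * (2 * IEY y z t s x r) ≤ STY y z t s x r := by
  have H' := H
  obtain ⟨hx0, hy, hz, ht, hs, -, -, -, -, hD⟩ := H'
  obtain ⟨hw, ha, hssw, hw', ha', hDr, h11⟩ := row_facts H hr
  obtain ⟨hQ, hβ1, hβx, hA1, hab, hB1, hCO1, hCE1, hR1, hG1, hG0', hUE01, hUO1, hUE1, hIE1, hIO1, hIO, hST1⟩ := potY_base H hr
  have hA0 : 0 ≤ AY y z t s x r := zero_le_one.trans hA1
  have hUO0 : 0 ≤ UOY y z t s x r := zero_le_one.trans hUO1
  have hCO0 : 0 ≤ COY s x := zero_le_one.trans hCO1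
  have hmax1 : 1 ≤ max (wr y z r) 1 := le_max_right _ _
  have hxs : x * s ≤ COY s x := le_max_right _ _
  refine ⟨?_, ?_, ?_, ?_, ?_, ?_, ?_, ?_, ?_, ?_, ?_, ?_⟩
  · have h0 : 0 ≤ x * wr y z r * (s * UOY y z t s x r) := by positivity
    unfold GY; nlinarith only [h0]
  · have h0 : 0 ≤ x * wr y z r * AY y z t s x r := by positivity
    unfold GY; nlinarith only [h0]
  · unfold UOY; exact le_max_left _ _
  · unfold UEY UE0
    calc x * (wr y z r * AY y z t s x r) = x * wr y z r * AY y z t s x r := by ring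
      _ ≤ _ := le_max_of_le_left (le_max_left _ _)
  · -- `x s UE ≤ UO`
    unfold UEY
    rcases le_total (UE0 y z t s x r) (x * s * wr y z r * UOY y z t s x r) with h1 | h1
    · rw [max_eq_right h1]
      calc x * (s * (x * s * wr y z r * UOY y z t s x r)) = (x ^ 2 * s ^ 2 * wr y z r) * UOY y z t s x r := by ring
        _ ≤ 1 * UOY y z t s x r := by gcongr
        _ = _ := one_mul _
    · rw [max_eq_left h1]
      calc x * (s * UE0 y z t s x r) = x * s * UE0 y z t s x r := by ring
        _ ≤ _ := by unfold UOY; exact le_max_of_le_right (le_max_right _ _)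
  · unfold UEY
    calc x * (s * (wr y z r * UOY y z t s x r)) = x * s * wr y z r * UOY y z t s x r := by ring
      _ ≤ _ := le_max_right _ _
  · have h0 : 0 ≤ x * wr y z r * (s * COY s x) := by positivity
    unfold RY; nlinarith only [h0]
  · unfold RY; nlinarith only [hw]
  · -- `x s CE ≤ CO`
    unfold CEY
    rcases le_total 1 (x * s * wr y z r * COY s x) with h1 | h1
    · rw [max_eq_right h1]
      calc x * (s * (x * s * wr y z r * COY s x)) = (x ^ 2 * s ^ 2 * wr y z r) * COY s x := by ring
        _ ≤ 1 * COY s x := by gcongr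
        _ = _ := one_mul _
    · rw [max_eq_left h1]; linarith
  · unfold CEY
    calc x * (s * (wr y z r * COY s x)) = x * s * wr y z r * COY s x := by ring
      _ ≤ _ := le_max_right _ _
  · unfold STY
    have h1 : wr y z r * IOY y z t s x r ≤ max (wr y z r) 1 * max (IEY y z t s x r) (IOY y z t s x r) :=
      mul_le_mul (le_max_left _ _) (le_max_right _ _) (zero_le_one.trans hIO1) (zero_le_one.trans hmax1)
    nlinarith only [h1, hx0]
  · unfold STY
    have h0 : 0 ≤ max (IEY y z t s x r) (IOY y z t s x r) := le_trans (zero_le_one.trans hIE1) (le_max_left _ _)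
    have h1 : IEY y z t s x r ≤ max (wr y z r) 1 * max (IEY y z t s x r) (IOY y z t s x r) := by
      nlinarith only [hmax1, le_max_left (IEY y z t s x r) (IOY y z t s x r), h0]
    have h2 : 0 ≤ t * GY y z t s x (1 - r) := mul_nonneg ht hG0'
    nlinarith only [h1, h2, hx0]

/-- `ΦY ≥ 1` everywhere (row `r ∈ {0,1}`). [cite: Stanley2012EC1, §4.7 (lane plumbing)] -/
theorem one_le_ΦY (H : PotHyp y z t s x) (st : LState) {r : ℤ} (hr : r = 0 ∨ r = 1) (c : Bool) :
    1 ≤ ΦY y z t s x st r c := by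
  obtain ⟨-, -, -, hA1, -, hB1, hCO1, hCE1, hR1, hG1, -, -, hUO1, hUE1, hIE1, hIO1, -, hST1⟩ := potY_base H hr
  rcases st with _ | k | A | i | k | k | k | j <;> simp only [ΦY] <;> try split_ifs
  all_goals assumption

/-- ★ **The supermartingale inequality of `ΦY`** at every CONSISTENT (state, parity) pair of row `r ∈ {0,1}`:
`x · stepSumY ΦY st r c ≤ ΦY st r c`. [cite: Stanley2012EC1, §4.7 (transfer-matrix method with weights); BeatonBousquetMelouDeGierDuminilCopinGuttmann2014, §3.2] -/
theorem ΦY_step (H : PotHyp y z t s x) (p : ℕ) (st : LState) {r : ℤ} (hr : r = 0 ∨ r = 1) {c : Bool} (hc : Cons p st c) :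
    x * stepSumY y z t s p (ΦY y z t s x) st r c ≤ ΦY y z t s x st r c := by
  obtain ⟨hQ, hβ1, hβx, hA1, hab, hB1, hCO1, hCE1, hR1, hG1, hG0', hUE01, hUO1, hUE1, hIE1, hIO1, hIO, hST1⟩ := potY_base H hr
  obtain ⟨hF1, hF2⟩ := potY_fwd H hr
  obtain ⟨hL1, hL2, hL3, hL4, hL5, hL6, hL7, hL8, hL9, hL10, hL11, hL12⟩ := potY_local H hr
  obtain ⟨hw, ha, -, hw', -, -, h11⟩ := row_facts H hr
  have hx0 := H.hx0; have ht := H.ht; have hs := H.hs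
  obtain ⟨hpar, hrg⟩ := hc
  have h1r : 1 - (1 - r) = r := h11
  -- weights: `wt r true = w_r`, `wt r false = 1`
  have hwt : ∀ ρ : ℤ, wt y z ρ true = wr y z ρ := fun ρ => by simp [wt, wr]
  have hwf : ∀ ρ : ℤ, wt y z ρ false = 1 := fun ρ => by simp [wt]
  rcases st with _ | k | (_ | j) | (_ | i) | k | k | (_ | j) | (_ | j)
  · -- start: c = !Even p
    have hc : c = !decide (Even p) := hpar _ rfl
    simp only [stepSumY, ΦY]
    by_cases hp : Even p
    · have : c = false := by rw [hc]; simp [hp]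
      subst this; simp only [if_pos hp, Bool.not_false, hwt, hwf, if_true]
      nlinarith only [hL11, hx0]
    · have : c = true := by rw [hc]; simp [hp]
      subst this; simp only [if_neg hp, Bool.not_true, hwf, add_zero]
      simp only [show (false = true) = False by simp, if_false]
      nlinarith only [hL12]
  · -- ini k: c = !Even (p+k+1)
    have hc : c = !decide (Even (p + k + 1)) := hpar _ rfl
    simp only [stepSumY, ΦY]
    by_cases hp : Even (p + k + 1)
    · have : c = false := by rw [hc]; simp [hp]
      subst this; simp only [if_pos hp, Bool.not_false, hwt, hwf, if_true, show (false = true) = False by simp, if_false]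
      linarith
    · have : c = true := by rw [hc]; simp [hp]
      subst this; simp only [if_neg hp, Bool.not_true, hwf, add_zero, if_true, show (false = true) = False by simp, if_false]
      rw [one_mul, hIO]
  · -- rg1 0: c = false
    have hc : c = false := hpar _ rfl
    subst hc; simp only [stepSumY, ΦY, Bool.not_false, hwt, if_true]; exact hL1
  · -- rg1 (j+1)
    have hc : c = false := hpar _ rfl
    subst hc; simp only [stepSumY, ΦY, Bool.not_false, hwt, if_true]; exact hL2
  · -- ut 0
    simp only [stepSumY, ΦY]
    cases c
    · simp only [Bool.not_false, hwt, if_true, show (false = true) = False by simp, if_false]; exact hL4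
    · simp only [Bool.not_true, hwf, if_true, show (false = true) = False by simp, if_false, one_mul]; exact hL3
  · -- ut (i+1)
    simp only [stepSumY, ΦY]
    cases c
    · simp only [Bool.not_false, hwt, if_true, show (false = true) = False by simp, if_false]; exact hL6
    · simp only [Bool.not_true, hwf, if_true, show (false = true) = False by simp, if_false, one_mul]; exact hL5
  · -- up k: rung iff Even (p+k+1) iff c = false
    have hc : c = !decide (Even (p + k + 1)) := hpar _ rfl
    simp only [stepSumY, ΦY]
    by_cases hp : Even (p + k + 1)
    · have : c = false := by rw [hc]; simp [hp]
      subst this; simp only [if_pos hp, Bool.not_false, hwt, hwf, if_true, show (false = true) = False by simp, if_false, one_mul]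
      exact hF1
    · have : c = true := by rw [hc]; simp [hp]
      subst this; simp only [if_neg hp, Bool.not_true, hwf, add_zero, if_true, show (false = true) = False by simp, if_false, one_mul]
      rw [hab]
  · -- fwd k: rung iff Even (k+1) iff c = false
    have hc : c = !decide (Even (k + 1)) := hpar _ rfl
    simp only [stepSumY, ΦY]
    by_cases hp : Even (k + 1)
    · have : c = false := by rw [hc]; simp [hp]
      subst this; simp only [if_pos hp, Bool.not_false, hwt, hwf, if_true, show (false = true) = False by simp, if_false, one_mul]
      exact hF1
    · have : c = true := by rw [hc]; simp [hp]
      subst this; simp only [if_neg hp, Bool.not_true, hwf, add_zero, if_true, show (false = true) = False by simp, if_false, one_mul]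
      rw [hab]
  · -- rg2 0
    have hc : c = false := hpar _ rfl
    subst hc; simp only [stepSumY, ΦY, Bool.not_false, hwt, if_true]; exact hL7
  · -- rg2 (j+1)
    have hc : c = false := hpar _ rfl
    subst hc; simp only [stepSumY, ΦY, Bool.not_false, hwt, if_true]; exact hL8
  · -- cor 0
    simp only [stepSumY, mul_zero]; exact (zero_le_one.trans (one_le_ΦY H _ hr c))
  · -- cor (j+1)
    simp only [stepSumY, ΦY]
    cases c
    · simp only [Bool.not_false, hwt, if_true, show (false = true) = False by simp, if_false]; exact hL10
    · simp only [Bool.not_true, hwf, if_true, show (false = true) = False by simp, if_false, one_mul]; exact hL9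

/-- The first-letter term is monotone in `F` on the successor and has a nonnegative prefactor. [cite: Stanley2012EC1, §4.7 (lane plumbing)] -/
theorem letterTerm_nonneg_factor (hy : 0 ≤ y) (hz : 0 ≤ z) (ht : 0 ≤ t) (hs : 0 ≤ s) (g g' : GState) (a : Site 2)
    (ℓ : Step) : 0 ≤ swt y z (a + Step.vec ℓ) * (t ^ (if Step.dy ℓ = 0 then 0 else 1) * s ^ (if isBack g.s g'.s then 1 else 0)) := by
  have : 0 ≤ swt y z (a + Step.vec ℓ) := by
    unfold swt wρ; cases par ((a + Step.vec ℓ) 0) <;> cases decide ((a + Step.vec ℓ) 1 = 1) <;> simp [hy, hz]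
  positivity

/-- ★★ **THE TWO-FUGACITY TILTED KRAFT INEQUALITY**: from every consistent configuration `g` at a site `a` of its row,
`(Σ_{w ∈ acc p g m} wprod(a,w) t^{nV w} s^{nB w}) · x^m ≤ ΦY(g.s, g.r, par a₀)`. [cite: Stanley2012EC1, §4.7 (transfer-matrix method with weights); BeatonBousquetMelouDeGierDuminilCopinGuttmann2014, §3.2 Proposition 6] -/
theorem sum_acc_weightY_mul_pow_le (H : PotHyp y z t s x) (p : ℕ) (m : ℕ) :
    ∀ (g : GState) (a : Site 2), HOk g → (g.r = 0 ∨ g.r = 1) → a 1 = g.r → Cons p g.s (par (a 0)) →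
      (∑ w ∈ acc p g m, wprod y z a w * (t ^ nV w * s ^ nB p g w)) * x ^ m ≤ ΦY y z t s x g.s g.r (par (a 0)) := by
  have hx0 := H.hx0
  induction m with
  | zero =>
    intro g a hg hr ha hc
    have hacc : acc p g 0 = {[]} := by
      ext w; simp only [acc, Finset.mem_filter, mem_words, List.length_eq_zero_iff, Finset.mem_singleton]
      constructor
      · exact fun h => h.1
      · rintro rfl; exact ⟨rfl, by simp⟩
    rw [hacc, Finset.sum_singleton]; simpa [wprod] using one_le_ΦY H g.s hr (par (a 0))
  | succ m ih =>
    intro g a hg hr ha hc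
    rw [sum_acc_succ, pow_succ, ← mul_assoc, Finset.sum_mul, mul_comm _ x]
    -- bound each letter's inner sum by `ΦY` at the (consistent) successor
    have hle : ∑ ℓ : Step, ((δ p g ℓ).elim 0 fun g' => ∑ w ∈ acc p g' m, wprod y z a (ℓ :: w) *
          (t ^ nV (ℓ :: w) * s ^ nB p g (ℓ :: w))) * x ^ m ≤ ∑ ℓ : Step, letterTerm y z t s p (ΦY y z t s x) g a ℓ := by
      refine Finset.sum_le_sum fun ℓ _ => ?_
      unfold letterTerm
      cases hδ : δ p g ℓ with
      | none => simp
      | some g' =>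
        have hstep := δ_eq_some (s := g.s) (h := g.h) (r := g.r) (s' := g'.s) (h' := g'.h) (r' := g'.r) hδ
        have hr' : g'.r = 0 ∨ g'.r = 1 := by rcases hstep with ⟨-, -, -, h4, -⟩ | ⟨-, -, -, h4, -⟩ <;> omega
        have hrow : (a + Step.vec ℓ) 1 = g'.r := by
          simp only [Pi.add_apply, Step.vec_apply_one]
          rcases hstep with ⟨hdy, -, -, h4, -⟩ | ⟨-, hdy, -, h4, -⟩ <;> rw [hdy, h4, ha] <;> ring
        have hg' : HOk g' := by
          obtain ⟨s₀, h₀, r₀⟩ := g; obtain ⟨s₁, h₁, r₁⟩ := g'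
          simp only at hstep hg
          rcases hstep with ⟨-, hdx, hh1, -, ⟨-, -, hB⟩ | ⟨-, hF⟩⟩ | ⟨-, -, hh1, -, hR⟩
          · rcases s₀ with _ | k | (_ | j) | i | k | k | (_ | j) | j <;>
              simp only [backT, Option.some.injEq, reduceCtorEq] at hB <;> subst hB <;> simp only [HOk] <;> omega
          · rcases s₀ with _ | k | A | (_ | i) | k | k | k | (_ | j) <;>
              simp only [fwdT, Option.some.injEq, reduceCtorEq] at hF <;> subst hF <;> simp only [HOk] <;> omega
          · rcases s₀ with _ | k | A | i | k | k | k | j <;> simp only [rungT, reduceCtorEq] at hR <;> split_ifs at hR <;>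
              simp only [Option.some.injEq] at hR <;> subst hR <;> simp only [HOk] at hg ⊢ <;> omega
        -- consistency of the successor: its parity is `nextPar`
        have hpar' : par ((a + Step.vec ℓ) 0) = nextPar (par (a 0)) ℓ := by
          simp only [Pi.add_apply, Step.vec_apply_zero, nextPar]
          rcases hstep with ⟨hdy, hdx, -, -, -⟩ | ⟨hdx, hdy, -, -, -⟩
          · rw [if_pos hdy]; rcases hdx with e | e <;> rw [e]
            · exact par_add_one' _
            · exact par_sub_one' _
          · rw [hdx, add_zero, if_neg (by omega)]
        have hc' : Cons p g'.s (par ((a + Step.vec ℓ) 0)) := by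
          rw [hpar']; obtain ⟨s₀, h₀, r₀⟩ := g; obtain ⟨s₁, h₁, r₁⟩ := g'; exact cons_step hc hδ
        have hih := ih g' (a + Step.vec ℓ) hg' hr' hrow hc'
        simp only [Option.elim]
        have hfac := letterTerm_nonneg_factor H.hy.le H.hz.le H.ht H.hs g g' a ℓ
        -- `Σ_w wprod a (ℓ::w) … = factor · Σ_w wprod a' w …`
        have hsplit : (∑ w ∈ acc p g' m, wprod y z a (ℓ :: w) * (t ^ nV (ℓ :: w) * s ^ nB p g (ℓ :: w))) * x ^ m =
            swt y z (a + Step.vec ℓ) * (t ^ (if Step.dy ℓ = 0 then 0 else 1) * s ^ (if isBack g.s g'.s then 1 else 0)) *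
              ((∑ w ∈ acc p g' m, wprod y z (a + Step.vec ℓ) w * (t ^ nV w * s ^ nB p g' w)) * x ^ m) := by
          simp only [wprod_cons, nV_cons, nB_cons_of_some p hδ, pow_add, Finset.sum_mul, Finset.mul_sum]
          exact Finset.sum_congr rfl fun w _ => by ring
        rw [hsplit]
        exact mul_le_mul_of_nonneg_left hih hfac
    -- sum over letters = one tilted step, then the supermartingale inequality
    obtain ⟨st, hh, r⟩ := g
    simp only at hr ha hg hc hle ⊢
    have hstep : ∑ ℓ : Step, letterTerm y z t s p (ΦY y z t s x) ⟨st, hh, r⟩ a ℓ = stepSumY y z t s p (ΦY y z t s x) st r (par (a 0)) := by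
      rcases hr with rfl | rfl
      · exact sum_letterTerm₀ y z t s p _ st hh hg a ha
      · exact sum_letterTerm₁ y z t s p _ st hh hg a ha
    calc x * (∑ ℓ : Step, ((δ p ⟨st, hh, r⟩ ℓ).elim 0 fun g' => ∑ w ∈ acc p g' m, wprod y z a (ℓ :: w) *
          (t ^ nV (ℓ :: w) * s ^ nB p ⟨st, hh, r⟩ (ℓ :: w))) * x ^ m)
        ≤ x * ∑ ℓ : Step, letterTerm y z t s p (ΦY y z t s x) ⟨st, hh, r⟩ a ℓ :=
          mul_le_mul_of_nonneg_left hle hx0.le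
      _ = x * stepSumY y z t s p (ΦY y z t s x) st r (par (a 0)) := by rw [hstep]
      _ ≤ _ := ΦY_step H p st hr hc

/-- `wprod ≥ 0` for nonnegative fugacities. [cite: BeatonBousquetMelouDeGierDuminilCopinGuttmann2014, §3.2 (lane plumbing)] -/
theorem wprod_nonneg (hy : 0 ≤ y) (hz : 0 ≤ z) (a : Site 2) (w : List Step) : 0 ≤ wprod y z a w := by
  induction w generalizing a with
  | nil => simp [wprod]
  | cons ℓ w ih =>
    rw [wprod_cons]
    have : 0 ≤ swt y z (a + Step.vec ℓ) := by
      unfold swt wρ; cases par ((a + Step.vec ℓ) 0) <;> cases decide ((a + Step.vec ℓ) 1 = 1) <;> simp [hy, hz]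
    exact mul_nonneg this (ih _)

/-! ## §4 Chernoff bounds for the deficit under the two-fugacity weights (word level) -/

/-- ★ **Weighted tilted deficit sum**: from the start configuration at a site `a` of row `r0 ∈ {0,1}`,
`Σ_{w ∈ acc N} wprod(a,w)·t^{defi w} ≤ ΦY(start, r0, par a₀)/x^N` (weights `t` per rung, `t²` per back step; `PotHyp` with `s = t²`).
[cite: Stanley2012EC1, §4.7 (transfer-matrix method with weights); BeatonBousquetMelouDeGierDuminilCopinGuttmann2014, §3.2] -/
theorem sum_wprod_pow_defi_le (H : PotHyp y z t (t ^ 2) x) (p : ℕ) {a : Site 2} (hp : Cons p start (par (a 0)))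
    (hr0 : a 1 = 0 ∨ a 1 = 1) (N : ℕ) :
    ∑ w ∈ acc p ⟨start, 0, a 1⟩ N, wprod y z a w * t ^ defi p (a 1) w ≤ ΦY y z t (t ^ 2) x start (a 1) (par (a 0)) / x ^ N := by
  have hx0 := H.hx0
  rw [le_div_iff₀ (pow_pos hx0 N)]
  have h := sum_acc_weightY_mul_pow_le H p N ⟨start, 0, a 1⟩ a (by simp [HOk]) (by simpa using hr0) rfl hp
  simp only at h
  calc (∑ w ∈ acc p ⟨start, 0, a 1⟩ N, wprod y z a w * t ^ defi p (a 1) w) * x ^ N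
      = (∑ w ∈ acc p ⟨start, 0, a 1⟩ N, wprod y z a w * (t ^ nV w * (t ^ 2) ^ nB p ⟨start, 0, a 1⟩ w)) * x ^ N := by
        congr 1; refine Finset.sum_congr rfl fun w _ => ?_; rw [← pow_mul, ← pow_add]; rfl
    _ ≤ _ := h

/-- ★ Chernoff, upper tail, weighted: for `t ≥ 1`, `(Σ_{w ∈ acc N, κ ≤ defi w} wprod(a,w))·t^κ ≤ ΦY(start)/x^N`.
[cite: Stanley2012EC1, §4.7 (transfer-matrix method with weights)] -/
theorem sum_wprod_defi_ge_mul_rpow_le (H : PotHyp y z t (t ^ 2) x) (ht1 : 1 ≤ t) (p : ℕ) {a : Site 2}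
    (hp : Cons p start (par (a 0))) (hr0 : a 1 = 0 ∨ a 1 = 1) (N : ℕ) (κ : ℝ) :
    (∑ w ∈ (acc p ⟨start, 0, a 1⟩ N).filter (fun w => κ ≤ defi p (a 1) w), wprod y z a w) * t ^ κ ≤
      ΦY y z t (t ^ 2) x start (a 1) (par (a 0)) / x ^ N := by
  classical
  have hy := H.hy.le; have hz := H.hz.le
  have ht0 : 0 ≤ t := zero_le_one.trans ht1
  rw [Finset.sum_mul]
  calc ∑ w ∈ (acc p ⟨start, 0, a 1⟩ N).filter (fun w => κ ≤ defi p (a 1) w), wprod y z a w * t ^ κ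
      ≤ ∑ w ∈ (acc p ⟨start, 0, a 1⟩ N).filter (fun w => κ ≤ defi p (a 1) w), wprod y z a w * t ^ defi p (a 1) w :=
        Finset.sum_le_sum fun w hw => by
          have hκ := (Finset.mem_filter.1 hw).2
          refine mul_le_mul_of_nonneg_left ?_ (wprod_nonneg hy hz a w)
          calc t ^ κ ≤ t ^ (defi p (a 1) w : ℝ) := Real.rpow_le_rpow_of_exponent_le ht1 hκ
            _ = t ^ defi p (a 1) w := Real.rpow_natCast t _
    _ ≤ ∑ w ∈ acc p ⟨start, 0, a 1⟩ N, wprod y z a w * t ^ defi p (a 1) w :=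
        Finset.sum_le_sum_of_subset_of_nonneg (Finset.filter_subset _ _) fun w _ _ =>
          mul_nonneg (wprod_nonneg hy hz a w) (pow_nonneg ht0 _)
    _ ≤ _ := sum_wprod_pow_defi_le H p hp hr0 N

/-- ★ Chernoff, lower tail, weighted: for `0 < t ≤ 1`, `(Σ_{w ∈ acc N, defi w ≤ κ} wprod(a,w))·t^κ ≤ ΦY(start)/x^N`.
[cite: Stanley2012EC1, §4.7 (transfer-matrix method with weights)] -/
theorem sum_wprod_defi_le_mul_rpow_le (H : PotHyp y z t (t ^ 2) x) (ht0 : 0 < t) (ht1 : t ≤ 1) (p : ℕ) {a : Site 2}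
    (hp : Cons p start (par (a 0))) (hr0 : a 1 = 0 ∨ a 1 = 1) (N : ℕ) (κ : ℝ) :
    (∑ w ∈ (acc p ⟨start, 0, a 1⟩ N).filter (fun w => (defi p (a 1) w : ℝ) ≤ κ), wprod y z a w) * t ^ κ ≤
      ΦY y z t (t ^ 2) x start (a 1) (par (a 0)) / x ^ N := by
  classical
  have hy := H.hy.le; have hz := H.hz.le
  rw [Finset.sum_mul]
  calc ∑ w ∈ (acc p ⟨start, 0, a 1⟩ N).filter (fun w => (defi p (a 1) w : ℝ) ≤ κ), wprod y z a w * t ^ κ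
      ≤ ∑ w ∈ (acc p ⟨start, 0, a 1⟩ N).filter (fun w => (defi p (a 1) w : ℝ) ≤ κ), wprod y z a w * t ^ defi p (a 1) w :=
        Finset.sum_le_sum fun w hw => by
          have hκ := (Finset.mem_filter.1 hw).2
          refine mul_le_mul_of_nonneg_left ?_ (wprod_nonneg hy hz a w)
          calc t ^ κ ≤ t ^ (defi p (a 1) w : ℝ) := Real.rpow_le_rpow_of_exponent_ge ht0 ht1 hκ
            _ = t ^ defi p (a 1) w := Real.rpow_natCast t _
    _ ≤ ∑ w ∈ acc p ⟨start, 0, a 1⟩ N, wprod y z a w * t ^ defi p (a 1) w :=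
        Finset.sum_le_sum_of_subset_of_nonneg (Finset.filter_subset _ _) fun w _ _ =>
          mul_nonneg (wprod_nonneg hy hz a w) (pow_nonneg ht0.le _)
    _ ≤ _ := sum_wprod_pow_defi_le H p hp hr0 N

end potential2

/-! ## §5 The tilts exist on both sides of `ρ(y,z)` (calculus at the critical point `x₀ = 1/μ_1(y,z)` of the sextic) -/

section calculusY

variable {y z μ κ : ℝ}

/-- The critical rung weight of a given `x` for the two-fugacity forward phase: `T(x)² yz x⁶ = (1 − yx²)(1 − zx²)`.
[cite: BeatonBousquetMelouDeGierDuminilCopinGuttmann2014, §3.2 Proposition 6 (arXiv v5 p. 10); Stanley2012EC1, §4.7] -/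
def cTY (y z x : ℝ) : ℝ := Real.sqrt ((1 - y * x ^ 2) * (1 - z * x ^ 2) / (y * z)) / x ^ 3

/-- The exponent function `G(x) = (1 − 3κ) log x + (κ/2)(log(1 − yx²) + log(1 − zx²) − log(yz)) + log μ = log(x·T(x)^κ·μ)`.
[cite: AlmJanson1990, via MadrasSlade1993 §8.5 pp. 278–279] -/
def cGY (y z μ κ x : ℝ) : ℝ :=
  (1 - 3 * κ) * Real.log x + κ / 2 * (Real.log (1 - y * x ^ 2) + Real.log (1 - z * x ^ 2) - Real.log (y * z)) + Real.log μ

/-- `exp G(x) = x · T(x)^κ · μ` on `0 < x`, `yx² < 1`, `zx² < 1`. [cite: AlmJanson1990, via MadrasSlade1993 §8.5 pp. 278–279 (lane plumbing)] -/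
theorem exp_cGY (hy : 0 < y) (hz : 0 < z) (hμ : 0 < μ) {x : ℝ} (hx0 : 0 < x) (hyx : y * x ^ 2 < 1) (hzx : z * x ^ 2 < 1) :
    Real.exp (cGY y z μ κ x) = x * cTY y z x ^ κ * μ := by
  have h1 : 0 < 1 - y * x ^ 2 := by linarith
  have h2 : 0 < 1 - z * x ^ 2 := by linarith
  have hq : 0 < (1 - y * x ^ 2) * (1 - z * x ^ 2) / (y * z) := by positivity
  have hT : 0 < cTY y z x := div_pos (Real.sqrt_pos.2 hq) (pow_pos hx0 3)
  unfold cGY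
  rw [Real.rpow_def_of_pos hT, cTY, Real.log_div (Real.sqrt_pos.2 hq).ne' (pow_pos hx0 3).ne', Real.log_sqrt hq.le,
    Real.log_div (mul_pos h1 h2).ne' (mul_pos hy hz).ne', Real.log_mul h1.ne' h2.ne', Real.log_pow]
  rw [show (1 - 3 * κ) * Real.log x + κ / 2 * (Real.log (1 - y * x ^ 2) + Real.log (1 - z * x ^ 2) - Real.log (y * z)) + Real.log μ
      = Real.log x + ((Real.log (1 - y * x ^ 2) + Real.log (1 - z * x ^ 2) - Real.log (y * z)) / 2 - ((3 : ℕ) : ℝ) * Real.log x) * κ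
        + Real.log μ by push_cast; ring]
  rw [Real.exp_add, Real.exp_add, Real.exp_log hx0, Real.exp_log hμ]

/-- The derivative of `G`. [cite: AlmJanson1990, via MadrasSlade1993 §8.5 pp. 278–279 (lane plumbing)] -/
theorem hasDerivAt_cGY (y z μ κ : ℝ) {x : ℝ} (hx0 : 0 < x) (hyx : y * x ^ 2 < 1) (hzx : z * x ^ 2 < 1) :
    HasDerivAt (cGY y z μ κ) ((1 - 3 * κ) * x⁻¹ + κ / 2 * (-(y * (2 * x)) / (1 - y * x ^ 2) + -(z * (2 * x)) / (1 - z * x ^ 2))) x := by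
  have h1 : 1 - y * x ^ 2 ≠ 0 := by linarith
  have h2 : 1 - z * x ^ 2 ≠ 0 := by linarith
  have hl : HasDerivAt (fun u => (1 - 3 * κ) * Real.log u) ((1 - 3 * κ) * x⁻¹) x := (Real.hasDerivAt_log hx0.ne').const_mul _
  have hp : HasDerivAt (fun u : ℝ => u ^ 2) (2 * x) x := by simpa using hasDerivAt_pow 2 x
  have hy' : HasDerivAt (fun u : ℝ => 1 - y * u ^ 2) (-(y * (2 * x))) x := by simpa using (hp.const_mul y).const_sub 1
  have hz' : HasDerivAt (fun u : ℝ => 1 - z * u ^ 2) (-(z * (2 * x))) x := by simpa using (hp.const_mul z).const_sub 1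
  have hsum : HasDerivAt (fun u => Real.log (1 - y * u ^ 2) + Real.log (1 - z * u ^ 2) - Real.log (y * z))
      (-(y * (2 * x)) / (1 - y * x ^ 2) + -(z * (2 * x)) / (1 - z * x ^ 2)) x := by
    simpa using ((hy'.log h1).add (hz'.log h2)).sub_const (Real.log (y * z))
  exact (hl.add (hsum.const_mul (κ / 2))).add_const (Real.log μ)

/-- **At the critical point** `x₀ = μ⁻¹` of a sextic `s(s − y)(s − z) = yz`, `s = μ²`, `y, z < s`: `T(x₀) = 1`, `G(x₀) = 0`, and
`G'(x₀) = μ·(1 − κ·M)` with `M = 3 + yx₀²/(1 − yx₀²) + zx₀²/(1 − zx₀²) = 1/ρ(y,z)`.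
[cite: BeatonBousquetMelouDeGierDuminilCopinGuttmann2014, §3.2 Proposition 6 (arXiv v5 p. 10)] -/
theorem cGY_facts (hy : 0 < y) (hz : 0 < z) (hμ : 0 < μ) (hys : y < μ ^ 2) (hzs : z < μ ^ 2)
    (hsex : μ ^ 2 * (μ ^ 2 - y) * (μ ^ 2 - z) = y * z) (κ : ℝ) :
    y * μ⁻¹ ^ 2 < 1 ∧ z * μ⁻¹ ^ 2 < 1 ∧ cTY y z μ⁻¹ = 1 ∧ cGY y z μ κ μ⁻¹ = 0 ∧
      (1 - 3 * κ) * (μ⁻¹)⁻¹ + κ / 2 * (-(y * (2 * μ⁻¹)) / (1 - y * μ⁻¹ ^ 2) + -(z * (2 * μ⁻¹)) / (1 - z * μ⁻¹ ^ 2)) =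
        μ * (1 - κ * (3 + y * μ⁻¹ ^ 2 / (1 - y * μ⁻¹ ^ 2) + z * μ⁻¹ ^ 2 / (1 - z * μ⁻¹ ^ 2))) := by
  have hμ2 : 0 < μ ^ 2 := by positivity
  have hyx : y * μ⁻¹ ^ 2 < 1 := by rw [inv_pow, mul_inv_lt_iff₀ hμ2]; linarith
  have hzx : z * μ⁻¹ ^ 2 < 1 := by rw [inv_pow, mul_inv_lt_iff₀ hμ2]; linarith
  have hcrit : (1 - y * μ⁻¹ ^ 2) * (1 - z * μ⁻¹ ^ 2) = y * z * (μ⁻¹ ^ 2) ^ 3 := by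
    field_simp; linear_combination hsex
  have hT : cTY y z μ⁻¹ = 1 := by
    unfold cTY
    rw [hcrit, show y * z * (μ⁻¹ ^ 2) ^ 3 / (y * z) = (μ⁻¹ ^ 3) ^ 2 by field_simp,
      Real.sqrt_sq (by positivity), div_self (by positivity)]
  refine ⟨hyx, hzx, hT, ?_, ?_⟩
  · have := exp_cGY (κ := κ) hy hz hμ (inv_pos.2 hμ) hyx hzx
    rw [hT, Real.one_rpow, mul_one, inv_mul_cancel₀ hμ.ne'] at this
    exact Real.exp_eq_one_iff _ |>.1 this
  · have h1 : 1 - y * μ⁻¹ ^ 2 ≠ 0 := by linarith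
    have h2 : 1 - z * μ⁻¹ ^ 2 ≠ 0 := by linarith
    field_simp
    ring

/-- `T` is strictly decreasing where it is defined: for `0 < x₁ < x₂` with `y x₂² < 1`, `z x₂² < 1`: `T(x₂) < T(x₁)`.
[cite: BeatonBousquetMelouDeGierDuminilCopinGuttmann2014, §3.2 (lane plumbing)] -/
theorem cTY_lt_cTY (hy : 0 < y) (hz : 0 < z) {x₁ x₂ : ℝ} (h1 : 0 < x₁) (h12 : x₁ < x₂) (hyx : y * x₂ ^ 2 < 1)
    (hzx : z * x₂ ^ 2 < 1) : cTY y z x₂ < cTY y z x₁ := by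
  have h2 : 0 < x₂ := h1.trans h12
  have hsq : x₁ ^ 2 < x₂ ^ 2 := by gcongr
  have hcube : x₁ ^ 3 < x₂ ^ 3 := by gcongr
  have hnum : (1 - y * x₂ ^ 2) * (1 - z * x₂ ^ 2) / (y * z) < (1 - y * x₁ ^ 2) * (1 - z * x₁ ^ 2) / (y * z) := by
    apply div_lt_div_of_pos_right _ (mul_pos hy hz)
    have ha : 0 < 1 - y * x₂ ^ 2 := by linarith
    have hb : 0 < 1 - z * x₂ ^ 2 := by linarith
    calc (1 - y * x₂ ^ 2) * (1 - z * x₂ ^ 2) < (1 - y * x₁ ^ 2) * (1 - z * x₂ ^ 2) := by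
          apply mul_lt_mul_of_pos_right _ hb; nlinarith
      _ ≤ (1 - y * x₁ ^ 2) * (1 - z * x₁ ^ 2) := by
          apply mul_le_mul_of_nonneg_left _ (by nlinarith); nlinarith
  unfold cTY
  have hpos : 0 < (1 - y * x₂ ^ 2) * (1 - z * x₂ ^ 2) / (y * z) := by
    have ha : 0 < 1 - y * x₂ ^ 2 := by linarith
    have hb : 0 < 1 - z * x₂ ^ 2 := by linarith
    positivity
  calc Real.sqrt ((1 - y * x₂ ^ 2) * (1 - z * x₂ ^ 2) / (y * z)) / x₂ ^ 3
      < Real.sqrt ((1 - y * x₁ ^ 2) * (1 - z * x₁ ^ 2) / (y * z)) / x₂ ^ 3 := by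
        apply div_lt_div_of_pos_right _ (pow_pos h2 3); exact Real.sqrt_lt_sqrt hpos.le hnum
    _ ≤ Real.sqrt ((1 - y * x₁ ^ 2) * (1 - z * x₁ ^ 2) / (y * z)) / x₁ ^ 3 :=
        div_le_div_of_nonneg_left (Real.sqrt_nonneg _) (pow_pos h1 3) hcube.le

/-- The critical relation: `DY y z t x = (1 − yx²)(1 − zx²) − t² yz x⁶`, and `T(x)² yz x⁶ = (1 − yx²)(1 − zx²)`.
[cite: Stanley2012EC1, §4.7 (lane plumbing)] -/
theorem DY_eq (y z t x : ℝ) : DY y z t x = (1 - y * x ^ 2) * (1 - z * x ^ 2) - t ^ 2 * (y * z) * x ^ 6 := by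
  simp only [DY, aY, bY, wr]; norm_num; ring

/-- `T(x)² · yz · x⁶ = (1 − yx²)(1 − zx²)`. [cite: Stanley2012EC1, §4.7 (lane plumbing)] -/
theorem cTY_sq_mul (hy : 0 < y) (hz : 0 < z) {x : ℝ} (hx0 : 0 < x) (hyx : y * x ^ 2 < 1) (hzx : z * x ^ 2 < 1) :
    cTY y z x ^ 2 * (y * z) * x ^ 6 = (1 - y * x ^ 2) * (1 - z * x ^ 2) := by
  have hq : 0 ≤ (1 - y * x ^ 2) * (1 - z * x ^ 2) / (y * z) := by
    have ha : 0 < 1 - y * x ^ 2 := by linarith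
    have hb : 0 < 1 - z * x ^ 2 := by linarith
    positivity
  unfold cTY; rw [div_pow, Real.sq_sqrt hq]; field_simp

/-- ★★ **THE UPPER TILT EXISTS** (two walls): with `μ > 0`, `μ²` the root of the sextic above `y, z`, and `κ·M > 1`
(`M = 1/ρ(y,z)`), there are `t > 1` and `x` with the potential hypotheses (`s = t²`) and `x·t^κ·μ > 1`.
[cite: AlmJanson1990, via MadrasSlade1993 §8.5 pp. 278–279; BeatonBousquetMelouDeGierDuminilCopinGuttmann2014, §3.2 Proposition 6] -/
theorem exists_tiltY_gt (hy : 0 < y) (hz : 0 < z) (hμ0 : 0 < μ) (hys : y < μ ^ 2) (hzs : z < μ ^ 2)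
    (hsex : μ ^ 2 * (μ ^ 2 - y) * (μ ^ 2 - z) = y * z)
    (hκ : 1 < κ * (3 + y * μ⁻¹ ^ 2 / (1 - y * μ⁻¹ ^ 2) + z * μ⁻¹ ^ 2 / (1 - z * μ⁻¹ ^ 2))) :
    ∃ t x : ℝ, 1 < t ∧ PotHyp y z t (t ^ 2) x ∧ 1 < x * t ^ κ * μ := by
  have hx00 : 0 < μ⁻¹ := inv_pos.2 hμ0
  obtain ⟨hyx, hzx, hT0, hG0, hder⟩ := cGY_facts hy hz hμ0 hys hzs hsex κ
  have hneg : μ * (1 - κ * (3 + y * μ⁻¹ ^ 2 / (1 - y * μ⁻¹ ^ 2) + z * μ⁻¹ ^ 2 / (1 - z * μ⁻¹ ^ 2))) < 0 :=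
    mul_neg_of_pos_of_neg hμ0 (by linarith)
  -- Step 1: `x₁ < x₀` with `G(x₁) > 0`, `x₁ T(x₁)² < 1`, `x₁² T(x₁)⁴ y < 1`, `x₁² T(x₁)⁴ z < 1`, `0 < x₁`
  have hD := hasDerivAt_cGY y z μ κ hx00 hyx hzx
  rw [hder] at hD
  have hslope := (hasDerivAt_iff_tendsto_slope.1 hD).eventually (gt_mem_nhds hneg)
  have hev1 : ∀ᶠ u in 𝓝[<] μ⁻¹, slope (cGY y z μ κ) μ⁻¹ u < 0 :=
    hslope.filter_mono (nhdsWithin_mono _ fun u hu => ne_of_lt hu)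
  have hev2 : ∀ᶠ u in 𝓝[<] μ⁻¹, u < μ⁻¹ := eventually_mem_nhdsWithin
  have hev3 : ∀ᶠ u in 𝓝[<] μ⁻¹, 0 < u := (lt_mem_nhds hx00).filter_mono nhdsWithin_le_nhds
  have hcT : ContinuousAt (cTY y z) μ⁻¹ := by
    unfold cTY
    have h3 : (μ⁻¹) ^ 3 ≠ 0 := pow_ne_zero _ hx00.ne'
    refine ContinuousAt.div ?_ (continuousAt_id.pow 3) h3
    exact ((((continuousAt_const.sub (continuousAt_const.mul (continuousAt_id.pow 2))).mul
      (continuousAt_const.sub (continuousAt_const.mul (continuousAt_id.pow 2)))).div_const _).sqrt)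
  have hev5 : ∀ᶠ u in 𝓝[<] μ⁻¹, u ^ 2 * (cTY y z u ^ 2) ^ 2 * y < 1 := by
    have hc : ContinuousAt (fun u => u ^ 2 * (cTY y z u ^ 2) ^ 2 * y) μ⁻¹ :=
      ((continuousAt_id.pow 2).mul ((hcT.pow 2).pow 2)).mul continuousAt_const
    have : μ⁻¹ ^ 2 * (cTY y z μ⁻¹ ^ 2) ^ 2 * y < 1 := by rw [hT0]; nlinarith
    exact (hc.eventually (gt_mem_nhds this)).filter_mono nhdsWithin_le_nhds
  have hev6 : ∀ᶠ u in 𝓝[<] μ⁻¹, u ^ 2 * (cTY y z u ^ 2) ^ 2 * z < 1 := by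
    have hc : ContinuousAt (fun u => u ^ 2 * (cTY y z u ^ 2) ^ 2 * z) μ⁻¹ :=
      ((continuousAt_id.pow 2).mul ((hcT.pow 2).pow 2)).mul continuousAt_const
    have : μ⁻¹ ^ 2 * (cTY y z μ⁻¹ ^ 2) ^ 2 * z < 1 := by rw [hT0]; nlinarith
    exact (hc.eventually (gt_mem_nhds this)).filter_mono nhdsWithin_le_nhds
  obtain ⟨x₁, h1, h2, h3, h5, h6⟩ := (hev1.and (hev2.and (hev3.and (hev5.and hev6)))).exists
  have hsq1 : x₁ ^ 2 < μ⁻¹ ^ 2 := by gcongr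
  have hyx1 : y * x₁ ^ 2 < 1 := (mul_lt_mul_of_pos_left hsq1 hy).trans hyx
  have hzx1 : z * x₁ ^ 2 < 1 := (mul_lt_mul_of_pos_left hsq1 hz).trans hzx
  have hG1 : 0 < cGY y z μ κ x₁ := by
    rw [slope_def_field, hG0, sub_zero] at h1
    rcases div_neg_iff.1 h1 with ⟨hpos, -⟩ | ⟨-, hpos⟩
    · exact hpos
    · linarith
  have hT1 : 1 < cTY y z x₁ := by rw [← hT0]; exact cTY_lt_cTY hy hz h3 h2 hyx hzx
  have hT10 : 0 < cTY y z x₁ := zero_lt_one.trans hT1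
  have hval : 1 < x₁ * cTY y z x₁ ^ κ * μ := by rw [← exp_cGY hy hz hμ0 h3 hyx1 hzx1]; exact Real.one_lt_exp_iff.2 hG1
  -- Step 2: `t < T(x₁)` close to `T(x₁)`
  have hevA : ∀ᶠ t in 𝓝[<] cTY y z x₁, 1 < t := (lt_mem_nhds hT1).filter_mono nhdsWithin_le_nhds
  have hcont : ContinuousAt (fun t : ℝ => x₁ * t ^ κ * μ) (cTY y z x₁) :=
    (continuousAt_const.mul (Real.continuousAt_rpow_const _ _ (Or.inl hT10.ne'))).mul continuousAt_const
  have hevB : ∀ᶠ t in 𝓝[<] cTY y z x₁, 1 < x₁ * t ^ κ * μ :=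
    (hcont.eventually (lt_mem_nhds hval)).filter_mono nhdsWithin_le_nhds
  have hevC : ∀ᶠ t in 𝓝[<] cTY y z x₁, t < cTY y z x₁ := eventually_mem_nhdsWithin
  obtain ⟨t, hA, hB, hC⟩ := (hevA.and (hevB.and hevC)).exists
  have ht0 : 0 < t := zero_lt_one.trans hA
  have ht2 : t ^ 2 < cTY y z x₁ ^ 2 := by gcongr
  have hTx := cTY_sq_mul hy hz h3 hyx1 hzx1
  have hDpos : 0 < DY y z t x₁ := by
    rw [DY_eq, ← hTx]
    have hx6 : 0 < x₁ ^ 6 := pow_pos h3 6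
    have := mul_lt_mul_of_pos_right (mul_lt_mul_of_pos_right ht2 (mul_pos hy hz)) hx6
    linarith
  refine ⟨t, x₁, hA, ⟨h3, hy, hz, ht0.le, by positivity, ?_, ?_, by linarith, by linarith, hDpos⟩, hB⟩
  · have : (t ^ 2) ^ 2 ≤ (cTY y z x₁ ^ 2) ^ 2 := by gcongr
    calc x₁ ^ 2 * (t ^ 2) ^ 2 * y ≤ x₁ ^ 2 * (cTY y z x₁ ^ 2) ^ 2 * y := by gcongr
      _ ≤ 1 := h5.le
  · have : (t ^ 2) ^ 2 ≤ (cTY y z x₁ ^ 2) ^ 2 := by gcongr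
    calc x₁ ^ 2 * (t ^ 2) ^ 2 * z ≤ x₁ ^ 2 * (cTY y z x₁ ^ 2) ^ 2 * z := by gcongr
      _ ≤ 1 := h6.le

/-- ★★ **THE LOWER TILT EXISTS** (two walls): for `κ·M < 1` there are `t ∈ (0,1)` and `x` with the potential hypotheses and
`x·t^κ·μ > 1`. [cite: AlmJanson1990, via MadrasSlade1993 §8.5 pp. 278–279; BeatonBousquetMelouDeGierDuminilCopinGuttmann2014, §3.2 Proposition 6] -/
theorem exists_tiltY_lt (hy : 0 < y) (hz : 0 < z) (hμ0 : 0 < μ) (hys : y < μ ^ 2) (hzs : z < μ ^ 2)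
    (hsex : μ ^ 2 * (μ ^ 2 - y) * (μ ^ 2 - z) = y * z)
    (hκ : κ * (3 + y * μ⁻¹ ^ 2 / (1 - y * μ⁻¹ ^ 2) + z * μ⁻¹ ^ 2 / (1 - z * μ⁻¹ ^ 2)) < 1) :
    ∃ t x : ℝ, 0 < t ∧ t < 1 ∧ PotHyp y z t (t ^ 2) x ∧ 1 < x * t ^ κ * μ := by
  have hx00 : 0 < μ⁻¹ := inv_pos.2 hμ0
  obtain ⟨hyx, hzx, hT0, hG0, hder⟩ := cGY_facts hy hz hμ0 hys hzs hsex κ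
  have hpos : 0 < μ * (1 - κ * (3 + y * μ⁻¹ ^ 2 / (1 - y * μ⁻¹ ^ 2) + z * μ⁻¹ ^ 2 / (1 - z * μ⁻¹ ^ 2))) :=
    mul_pos hμ0 (by linarith)
  have hD := hasDerivAt_cGY y z μ κ hx00 hyx hzx
  rw [hder] at hD
  have hslope := (hasDerivAt_iff_tendsto_slope.1 hD).eventually (lt_mem_nhds hpos)
  have hev1 : ∀ᶠ u in 𝓝[>] μ⁻¹, 0 < slope (cGY y z μ κ) μ⁻¹ u :=
    hslope.filter_mono (nhdsWithin_mono _ fun u hu => ne_of_gt hu)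
  have hev2 : ∀ᶠ u in 𝓝[>] μ⁻¹, μ⁻¹ < u := eventually_mem_nhdsWithin
  have hev4 : ∀ᶠ u in 𝓝[>] μ⁻¹, y * u ^ 2 < 1 :=
    ((continuousAt_const.mul (continuousAt_id.pow 2)).eventually (gt_mem_nhds hyx)).filter_mono nhdsWithin_le_nhds
  have hev5 : ∀ᶠ u in 𝓝[>] μ⁻¹, z * u ^ 2 < 1 :=
    ((continuousAt_const.mul (continuousAt_id.pow 2)).eventually (gt_mem_nhds hzx)).filter_mono nhdsWithin_le_nhds
  obtain ⟨x₁, h1, h2, h4, h5⟩ := (hev1.and (hev2.and (hev4.and hev5))).exists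
  have hx10 : 0 < x₁ := hx00.trans h2
  have hG1 : 0 < cGY y z μ κ x₁ := by
    rw [slope_def_field, hG0, sub_zero] at h1
    rcases div_pos_iff.1 h1 with ⟨hpos, -⟩ | ⟨-, hneg⟩
    · exact hpos
    · linarith
  have hT1 : cTY y z x₁ < 1 := by rw [← hT0]; exact cTY_lt_cTY hy hz hx00 h2 h4 h5
  have hT10 : 0 < cTY y z x₁ := by
    unfold cTY
    have ha : 0 < 1 - y * x₁ ^ 2 := by linarith
    have hb : 0 < 1 - z * x₁ ^ 2 := by linarith
    exact div_pos (Real.sqrt_pos.2 (by positivity)) (pow_pos hx10 3)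
  have hval : 1 < x₁ * cTY y z x₁ ^ κ * μ := by rw [← exp_cGY hy hz hμ0 hx10 h4 h5]; exact Real.one_lt_exp_iff.2 hG1
  have hevA : ∀ᶠ t in 𝓝[<] cTY y z x₁, 0 < t := (lt_mem_nhds hT10).filter_mono nhdsWithin_le_nhds
  have hcont : ContinuousAt (fun t : ℝ => x₁ * t ^ κ * μ) (cTY y z x₁) :=
    (continuousAt_const.mul (Real.continuousAt_rpow_const _ _ (Or.inl hT10.ne'))).mul continuousAt_const
  have hevB : ∀ᶠ t in 𝓝[<] cTY y z x₁, 1 < x₁ * t ^ κ * μ :=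
    (hcont.eventually (lt_mem_nhds hval)).filter_mono nhdsWithin_le_nhds
  have hevC : ∀ᶠ t in 𝓝[<] cTY y z x₁, t < cTY y z x₁ := eventually_mem_nhdsWithin
  obtain ⟨t, hA, hB, hC⟩ := (hevA.and (hevB.and hevC)).exists
  have ht1 : t < 1 := hC.trans hT1
  have ht2 : t ^ 2 < cTY y z x₁ ^ 2 := by gcongr
  have hTx := cTY_sq_mul hy hz hx10 h4 h5
  have ht21 : t ^ 2 ≤ 1 := by nlinarith only [hA, ht1]
  have ht4 : (t ^ 2) ^ 2 ≤ 1 := by nlinarith only [ht21, hA]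
  have hDpos : 0 < DY y z t x₁ := by
    rw [DY_eq, ← hTx]
    have hx6 : 0 < x₁ ^ 6 := pow_pos hx10 6
    have := mul_lt_mul_of_pos_right (mul_lt_mul_of_pos_right ht2 (mul_pos hy hz)) hx6
    linarith
  refine ⟨t, x₁, hA, ht1, ⟨hx10, hy, hz, hA.le, by positivity, ?_, ?_, by linarith, by linarith, hDpos⟩, hB⟩
  · calc x₁ ^ 2 * (t ^ 2) ^ 2 * y ≤ x₁ ^ 2 * 1 * y := by gcongr
      _ ≤ 1 := by nlinarith only [h4]
  · calc x₁ ^ 2 * (t ^ 2) ^ 2 * z ≤ x₁ ^ 2 * 1 * z := by gcongr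
      _ ≤ 1 := by nlinarith only [h5]

end calculusY

end WidthOne

/-! ## §6 The walks of `S_N(S_1)` under the two-fugacity weights: both deficit tails are exponentially small -/

section pairsY

open WidthOne WidthOne.LState WidthOneYZ

variable {y z : ℝ}

/-- The printed weight `y^{bc(ω)} z^{tc(ω)}` of a walk of `S_N(S_1)` (the summand of `stripZ₂ 1 N y z = C_{1,N}(y,z)`).
[cite: BeatonBousquetMelouDeGierDuminilCopinGuttmann2014, §3.2 (arXiv v5 p. 10: C_{T,k}(y,z) = Σ y^{bc(ω)} z^{tc(ω)})] -/
def wgt (y z : ℝ) (N : ℕ) (q : Site 2 × (ℕ → Site 2)) : ℝ := y ^ bottomVisits₀ q.1 q.2 N * z ^ topVisits₀ 1 q.1 q.2 N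

/-- `C_{1,N}(y,z) = Σ_q wgt q`. [cite: BeatonBousquetMelouDeGierDuminilCopinGuttmann2014, §3.2 (arXiv v5 p. 10)] -/
theorem stripZ₂_one_eq_sum_wgt (N : ℕ) : stripZ₂ 1 N y z = ∑ q ∈ stripPairs 1 N, wgt y z N q := rfl

/-- `wgt ≥ 0` for nonnegative fugacities. [cite: BeatonBousquetMelouDeGierDuminilCopinGuttmann2014, §3.2 (lane plumbing)] -/
theorem wgt_nonneg (hy : 0 ≤ y) (hz : 0 ≤ z) (N : ℕ) (q : Site 2 × (ℕ → Site 2)) : 0 ≤ wgt y z N q := by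
  unfold wgt; positivity

/-- **`M(y,z) = 3 + yx₀²/(1 − yx₀²) + zx₀²/(1 − zx₀²)`**, `x₀ = 1/μ_1(y,z)`: the reciprocal of the deficit density.
[cite: BeatonBousquetMelouDeGierDuminilCopinGuttmann2014, §3.2 Proposition 6 (arXiv v5 p. 10)] -/
def twoWallM (y z : ℝ) : ℝ :=
  3 + y * (stripMuY₂ 1 y z)⁻¹ ^ 2 / (1 - y * (stripMuY₂ 1 y z)⁻¹ ^ 2) + z * (stripMuY₂ 1 y z)⁻¹ ^ 2 / (1 - z * (stripMuY₂ 1 y z)⁻¹ ^ 2)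

/-- ★ **The two-wall deficit density `ρ(y,z) = 1/M(y,z)`** (closed form `twoWallRho_eq` below), and the two-wall speed
`v(y,z) = 1 − ρ(y,z)`. At `y = z = 1`: `ρ = 1/(2μ+3)`, `v = 2(μ+1)/(2μ+3)` (`HexBW.stripOneSpeed`).
[cite: BeatonBousquetMelouDeGierDuminilCopinGuttmann2014, §3.2 Proposition 6 (arXiv v5 p. 10); AlmJanson1990, via MadrasSlade1993 §8.5 pp. 278–279] -/
def twoWallRho (y z : ℝ) : ℝ := 1 / twoWallM y z

/-- **The two-wall speed** `v(y,z) = 1 − ρ(y,z)`. [cite: MadrasSlade1993, §1.1 eq. (1.1.5); BeatonBousquetMelouDeGierDuminilCopinGuttmann2014, §3.2] -/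
def twoWallSpeed (y z : ℝ) : ℝ := 1 - twoWallRho y z

/-- Facts at the critical point from the tree's SEXTIC LAW: `y x₀², z x₀² < 1`, `M > 0`, and the sextic in the form used by §5.
[cite: BeatonBousquetMelouDeGierDuminilCopinGuttmann2014, §3.2 Proposition 6 (arXiv v5 p. 10)] -/
theorem twoWall_critical_facts (hy : 0 < y) (hz : 0 < z) :
    y * (stripMuY₂ 1 y z)⁻¹ ^ 2 < 1 ∧ z * (stripMuY₂ 1 y z)⁻¹ ^ 2 < 1 ∧ 0 < twoWallM y z ∧
    stripMuY₂ 1 y z ^ 2 * (stripMuY₂ 1 y z ^ 2 - y) * (stripMuY₂ 1 y z ^ 2 - z) = y * z := by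
  have hμ := stripMuY₂_pos 1 hy hz
  obtain ⟨hys, hzs⟩ := lt_stripMuY₂_one_sq₂ hy hz
  have hsex := stripMuY₂_one_sq_poly_eq hy hz
  obtain ⟨hyx, hzx, -, -, -⟩ := cGY_facts hy hz hμ hys hzs hsex 0
  refine ⟨hyx, hzx, ?_, hsex⟩
  unfold twoWallM
  have h1 : 0 ≤ y * (stripMuY₂ 1 y z)⁻¹ ^ 2 / (1 - y * (stripMuY₂ 1 y z)⁻¹ ^ 2) := div_nonneg (by positivity) (by linarith)
  have h2 : 0 ≤ z * (stripMuY₂ 1 y z)⁻¹ ^ 2 / (1 - z * (stripMuY₂ 1 y z)⁻¹ ^ 2) := div_nonneg (by positivity) (by linarith)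
  linarith

/-- ★ **The closed form** `ρ(y,z) = yz x₀⁴ / ( y(1 − z x₀²) + z(1 − y x₀²) + 3yz x₀⁴ )`, `x₀ = 1/μ_1(y,z)` (by the sextic
`(1 − yx₀²)(1 − zx₀²) = yz x₀⁶`). [cite: BeatonBousquetMelouDeGierDuminilCopinGuttmann2014, §3.2 Proposition 6 (arXiv v5 p. 10)] -/
theorem twoWallRho_eq (hy : 0 < y) (hz : 0 < z) :
    twoWallRho y z = y * z * (stripMuY₂ 1 y z)⁻¹ ^ 4 /
      (y * (1 - z * (stripMuY₂ 1 y z)⁻¹ ^ 2) + z * (1 - y * (stripMuY₂ 1 y z)⁻¹ ^ 2) + 3 * y * z * (stripMuY₂ 1 y z)⁻¹ ^ 4) := by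
  obtain ⟨hyx, hzx, hM, hsex⟩ := twoWall_critical_facts hy hz
  have hμ := stripMuY₂_pos 1 hy hz
  have hcrit : (1 - y * (stripMuY₂ 1 y z)⁻¹ ^ 2) * (1 - z * (stripMuY₂ 1 y z)⁻¹ ^ 2) = y * z * (stripMuY₂ 1 y z)⁻¹ ^ 6 := by
    field_simp; linear_combination hsex
  unfold twoWallRho twoWallM at *
  generalize hu : (stripMuY₂ 1 y z)⁻¹ = u at *
  have h1 : 1 - y * u ^ 2 ≠ 0 := by linarith
  have h2 : 1 - z * u ^ 2 ≠ 0 := by linarith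
  have ha : 0 < 1 - z * u ^ 2 := by linarith
  have hb : 0 < 1 - y * u ^ 2 := by linarith
  have hu0 : 0 < u := by rw [← hu]; positivity
  have hden : 0 < y * (1 - z * u ^ 2) + z * (1 - y * u ^ 2) + 3 * y * z * u ^ 4 := by positivity
  rw [div_eq_div_iff hM.ne' hden.ne', one_mul]
  have key : (y * (1 - z * u ^ 2) + z * (1 - y * u ^ 2) + 3 * y * z * u ^ 4) * ((1 - y * u ^ 2) * (1 - z * u ^ 2)) =
      y * z * u ^ 4 * (3 * ((1 - y * u ^ 2) * (1 - z * u ^ 2)) + y * u ^ 2 * (1 - z * u ^ 2) + z * u ^ 2 * (1 - y * u ^ 2)) := by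
    rw [hcrit]; ring
  apply mul_right_cancel₀ (mul_ne_zero h1 h2)
  rw [key]
  field_simp

/-- ★ **The regime `μ_1(y,z) > 1` is exactly `y + z > 1`** (by the sextic law at `s = 1`: `(1 − y)(1 − z) = yz ⟺ y + z = 1`).
[cite: BeatonBousquetMelouDeGierDuminilCopinGuttmann2014, §3.2 Proposition 6 (arXiv v5 p. 10)] -/
theorem one_lt_stripMuY₂_one_iff (hy : 0 < y) (hz : 0 < z) : 1 < stripMuY₂ 1 y z ↔ 1 < y + z := by
  have hμ := stripMuY₂_pos 1 hy hz
  obtain ⟨hys, hzs⟩ := lt_stripMuY₂_one_sq₂ hy hz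
  by_cases hm : max y z ≤ 1
  · have key := stripMuY₂_one_le_iff hy hz one_pos (by simpa using hm)
    constructor
    · intro h
      by_contra hyz
      have : y * z ≤ 1 ^ 2 * (1 ^ 2 - y) * (1 ^ 2 - z) := by nlinarith
      linarith [key.2 this]
    · intro h
      by_contra hle
      have := key.1 (not_lt.1 hle)
      nlinarith
  · rw [not_le] at hm
    have h1 : 1 < stripMuY₂ 1 y z ^ 2 := by
      rcases lt_max_iff.1 hm with h | h <;> linarith
    constructor
    · intro; rcases lt_max_iff.1 hm with h | h <;> linarith
    · intro
      by_contra hle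
      rw [not_lt] at hle
      nlinarith [pow_le_one₀ (n := 2) hμ.le hle]

/-- ★ **Consistency with the unweighted walk**: `ρ(1,1) = 1/(2μ+3)` and `v(1,1) = 2(μ+1)/(2μ+3) = HexBW.stripOneSpeed`
(`μ_1(1,1) = μ(S_1)`, `μ³ = μ + 1`). [cite: MadrasSlade1993, §1.1 eq. (1.1.5); BeatonBousquetMelouDeGierDuminilCopinGuttmann2014, §3.2 Proposition 6 (arXiv v5 p. 10)] -/
theorem twoWallSpeed_one_one : twoWallRho 1 1 = 1 / (2 * stripConnectiveConstant 1 + 3) ∧ twoWallSpeed 1 1 = stripOneSpeed := by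
  have hμeq : stripMuY₂ 1 1 1 = stripConnectiveConstant 1 := stripMuY₂_one_one_one 1
  set μ := stripConnectiveConstant 1 with hμ
  have hμ1 : 1 < μ := by have := stripConnectiveConstant_one_mem_Ioo.1; rw [← hμ] at this; linarith
  have hμ0 : 0 < μ := by linarith
  have hc : μ ^ 3 = μ + 1 := by rw [hμ]; exact stripConnectiveConstant_one_pow_three
  have hx : 1 - 1 * μ⁻¹ ^ 2 = μ⁻¹ ^ 3 := by field_simp; linear_combination hc
  have hM : twoWallM 1 1 = 2 * μ + 3 := by
    unfold twoWallM; rw [hμeq, hx]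
    have h3 : μ⁻¹ ^ 3 ≠ 0 := pow_ne_zero _ (inv_ne_zero hμ0.ne')
    field_simp
    ring
  have hρ : twoWallRho 1 1 = 1 / (2 * μ + 3) := by unfold twoWallRho; rw [hM]
  refine ⟨hρ, ?_⟩
  rw [twoWallSpeed, hρ, stripOneSpeed_eq]

open Classical in
/-- **The weighted fibre of a deficit event over a starting site** is the weighted sum over the accepted words with that deficit:
`Σ_{q : P(N − |X(q)|), q₁ = a} y^{bc} z^{tc} = swt(a) · Σ_{w ∈ acc, P(defi w)} wprod(a, w)`.
[cite: BeatonBousquetMelouDeGierDuminilCopinGuttmann2014, §3.2 (arXiv v5 p. 10); MadrasSlade1993, §8.2 eq. (8.2.1)] -/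
theorem sum_filter_wgt_eq (N : ℕ) (P : ℝ → Prop) [DecidablePred P] {a : Site 2} (ha : a ∈ stripStarts 1) :
    ∑ q ∈ (stripPairs 1 N).filter (fun q => P ((N : ℝ) - |(q.2 N 0 : ℝ)|) ∧ q.1 = a), wgt y z N q =
      swt y z a * ∑ w ∈ (acc (a 0).toNat ⟨start, 0, a 1⟩ N).filter (fun w => P (defi (a 0).toNat (a 1) w)), wprod y z a w := by
  classical
  obtain ⟨⟨ha0, ha0'⟩, ha1, ha1'⟩ := mem_stripStarts.1 ha
  have hfilt : (stripPairs 1 N).filter (fun q => P ((N : ℝ) - |(q.2 N 0 : ℝ)|) ∧ q.1 = a) =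
      ((stripPairs 1 N).filter (fun q => q.1 = a)).filter (fun q => P ((N : ℝ) - |(q.2 N 0 : ℝ)|)) := by
    rw [Finset.filter_filter]; congr 1; ext q; exact and_comm
  rw [hfilt, filter_stripPairs_eq N ha, Finset.filter_image, Finset.sum_image]
  swap
  · intro w hw w' hw' h
    simp only [Finset.mem_coe, Finset.mem_filter, acc, mem_words] at hw hw'
    simp only [Prod.mk.injEq, true_and] at h
    exact eq_of_traj_eq (hw.1.1.trans hw'.1.1.symm) h
  rw [Finset.mul_sum]
  have hset : (acc (a 0).toNat (startG a) N).filter (fun w => P ((N : ℝ) - |((a, traj w).2 N 0 : ℝ)|)) =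
      (acc (a 0).toNat ⟨start, 0, a 1⟩ N).filter (fun w => P (defi (a 0).toNat (a 1) w)) := by
    ext w
    simp only [Finset.mem_filter, acc, mem_words, startG]
    constructor
    · rintro ⟨hw, hP⟩
      refine ⟨hw, ?_⟩
      have hd := defi_eq (a 0).toNat (a 1) hw.2
      have e1 : (traj w N) 0 = dX w := by rw [dX, ← hw.1, traj_length]
      have e2 : (defi (a 0).toNat (a 1) w : ℝ) = (N : ℝ) - |(dX w : ℝ)| := by
        have : ((defi (a 0).toNat (a 1) w : ℤ) : ℝ) = ((w.length : ℤ) - |dX w| : ℤ) := by rw [hd]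
        push_cast at this; rw [this, hw.1]
      rw [e2]; simpa [e1] using hP
    · rintro ⟨hw, hP⟩
      refine ⟨hw, ?_⟩
      have hd := defi_eq (a 0).toNat (a 1) hw.2
      have e1 : (traj w N) 0 = dX w := by rw [dX, ← hw.1, traj_length]
      have e2 : (defi (a 0).toNat (a 1) w : ℝ) = (N : ℝ) - |(dX w : ℝ)| := by
        have : ((defi (a 0).toNat (a 1) w : ℤ) : ℝ) = ((w.length : ℤ) - |dX w| : ℤ) := by rw [hd]
        push_cast at this; rw [this, hw.1]
      simp only [e1]; rwa [← e2]
  rw [hset]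
  refine Finset.sum_congr rfl fun w hw => ?_
  simp only [Finset.mem_filter, acc, mem_words] at hw
  have hgood : Good a w := (good_iff_isSome (p := (a 0).toNat) (Int.toNat_of_nonneg ha0).symm
    (by push_cast at ha1'; omega) w).2 hw.1.2
  unfold wgt
  rw [← hw.1.1, pow_visits_eq_prod, prod_swt_traj]
  intro m hm
  have := hgood.2.2 m hm
  simp only [InStrip, Nat.cast_one] at this
  show (a + traj w m) 1 = 0 ∨ (a + traj w m) 1 = 1
  omega

/-- The starting configuration at a starting site is consistent with the parity of its column. [cite: Stanley2012EC1, §4.7 (lane plumbing)] -/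
theorem cons_start_site {a : Site 2} (ha : a ∈ stripStarts 1) : Cons (a 0).toNat start (par (a 0)) := by
  obtain ⟨⟨ha0, ha0'⟩, -, -⟩ := mem_stripStarts.1 ha
  rcases (show a 0 = 0 ∨ a 0 = 1 by omega) with h | h
  · have : Cons 0 start (par 0) := by simpa [par] using cons_start 0
    simpa [h] using this
  · have : Cons 1 start (par 1) := by simpa [par] using cons_start 1
    simpa [h] using this

/-- The constant of the walk-level Chernoff bound: `Σ_{a ∈ starts} swt(a)·ΦY(start, a₁, par a₀)`.
[cite: Stanley2012EC1, §4.7 (lane plumbing)] -/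
def startConst (y z t x : ℝ) : ℝ := ∑ a ∈ stripStarts 1, swt y z a * ΦY y z t (t ^ 2) x start (a 1) (par (a 0))

open Classical in
/-- ★★ **Chernoff for the weighted walks, upper tail**: `(Σ_{q : κN ≤ N − |X(q)|} wgt q)·t^{κN} ≤ startConst/x^N` (`t ≥ 1`).
[cite: Stanley2012EC1, §4.7 (transfer-matrix method with weights); BeatonBousquetMelouDeGierDuminilCopinGuttmann2014, §3.2] -/
theorem sum_wgt_deficit_ge_le {t x : ℝ} (H : PotHyp y z t (t ^ 2) x) (ht1 : 1 ≤ t) (N : ℕ) (κ : ℝ) :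
    (∑ q ∈ (stripPairs 1 N).filter (fun q => κ * N ≤ (N : ℝ) - |(q.2 N 0 : ℝ)|), wgt y z N q) * t ^ (κ * N) ≤
      startConst y z t x / x ^ N := by
  classical
  -- fibrewise over the starting sites
  have hdecomp : ∑ q ∈ (stripPairs 1 N).filter (fun q => κ * N ≤ (N : ℝ) - |(q.2 N 0 : ℝ)|), wgt y z N q =
      ∑ a ∈ stripStarts 1, ∑ q ∈ (stripPairs 1 N).filter (fun q => (κ * N ≤ (N : ℝ) - |(q.2 N 0 : ℝ)|) ∧ q.1 = a), wgt y z N q := by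
    rw [← Finset.sum_fiberwise_of_maps_to (s := (stripPairs 1 N).filter (fun q => κ * N ≤ (N : ℝ) - |(q.2 N 0 : ℝ)|))
      (t := stripStarts 1) (g := Prod.fst) (fun q hq => (mem_stripPairs.1 (Finset.mem_filter.1 hq).1).1)]
    refine Finset.sum_congr rfl fun a _ => ?_
    rw [Finset.filter_filter]
  rw [hdecomp, Finset.sum_mul, startConst, Finset.sum_div]
  refine Finset.sum_le_sum fun a ha => ?_
  obtain ⟨⟨ha0, ha0'⟩, ha1, ha1'⟩ := mem_stripStarts.1 ha
  have hr : a 1 = 0 ∨ a 1 = 1 := by simp only [Nat.cast_one] at ha1'; omega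
  rw [sum_filter_wgt_eq N (fun d => κ * N ≤ d) ha, mul_assoc, mul_div_assoc]
  have hswt : 0 ≤ swt y z a := by
    unfold swt wρ; cases par (a 0) <;> cases decide (a 1 = 1) <;> simp [H.hy.le, H.hz.le]
  refine mul_le_mul_of_nonneg_left ?_ hswt
  have := sum_wprod_defi_ge_mul_rpow_le H ht1 (a 0).toNat (cons_start_site ha) hr N (κ * N)
  simpa using this

open Classical in
/-- ★★ **Chernoff for the weighted walks, lower tail**: `(Σ_{q : N − |X(q)| ≤ κN} wgt q)·t^{κN} ≤ startConst/x^N` (`0 < t ≤ 1`).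
[cite: Stanley2012EC1, §4.7 (transfer-matrix method with weights); BeatonBousquetMelouDeGierDuminilCopinGuttmann2014, §3.2] -/
theorem sum_wgt_deficit_le_le {t x : ℝ} (H : PotHyp y z t (t ^ 2) x) (ht0 : 0 < t) (ht1 : t ≤ 1) (N : ℕ) (κ : ℝ) :
    (∑ q ∈ (stripPairs 1 N).filter (fun q => (N : ℝ) - |(q.2 N 0 : ℝ)| ≤ κ * N), wgt y z N q) * t ^ (κ * N) ≤
      startConst y z t x / x ^ N := by
  classical
  have hdecomp : ∑ q ∈ (stripPairs 1 N).filter (fun q => (N : ℝ) - |(q.2 N 0 : ℝ)| ≤ κ * N), wgt y z N q =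
      ∑ a ∈ stripStarts 1, ∑ q ∈ (stripPairs 1 N).filter (fun q => ((N : ℝ) - |(q.2 N 0 : ℝ)| ≤ κ * N) ∧ q.1 = a), wgt y z N q := by
    rw [← Finset.sum_fiberwise_of_maps_to (s := (stripPairs 1 N).filter (fun q => (N : ℝ) - |(q.2 N 0 : ℝ)| ≤ κ * N))
      (t := stripStarts 1) (g := Prod.fst) (fun q hq => (mem_stripPairs.1 (Finset.mem_filter.1 hq).1).1)]
    refine Finset.sum_congr rfl fun a _ => ?_
    rw [Finset.filter_filter]
  rw [hdecomp, Finset.sum_mul, startConst, Finset.sum_div]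
  refine Finset.sum_le_sum fun a ha => ?_
  obtain ⟨⟨ha0, ha0'⟩, ha1, ha1'⟩ := mem_stripStarts.1 ha
  have hr : a 1 = 0 ∨ a 1 = 1 := by simp only [Nat.cast_one] at ha1'; omega
  rw [sum_filter_wgt_eq N (fun d => d ≤ κ * N) ha, mul_assoc, mul_div_assoc]
  have hswt : 0 ≤ swt y z a := by
    unfold swt wρ; cases par (a 0) <;> cases decide (a 1 = 1) <;> simp [H.hy.le, H.hz.le]
  refine mul_le_mul_of_nonneg_left ?_ hswt
  have := sum_wprod_defi_le_mul_rpow_le H ht0 ht1 (a 0).toNat (cons_start_site ha) hr N (κ * N)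
  simpa using this

/-! ## §7 The two-wall law of large numbers: deficit tails `≤ C θ^N C_{1,N}(y,z)` and `|X(ω)|/N → v(y,z)` in `P_{N,y,z}`-probability -/

/-- `startConst ≥ 0`. [cite: Stanley2012EC1, §4.7 (lane plumbing)] -/
theorem startConst_nonneg {t x : ℝ} (H : PotHyp y z t (t ^ 2) x) : 0 ≤ startConst y z t x := by
  unfold startConst
  refine Finset.sum_nonneg fun a ha => ?_
  obtain ⟨-, ha1, ha1'⟩ := mem_stripStarts.1 ha
  have hr : a 1 = 0 ∨ a 1 = 1 := by simp only [Nat.cast_one] at ha1'; omega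
  have hswt : 0 ≤ swt y z a := by
    unfold swt wρ; cases par (a 0) <;> cases decide (a 1 = 1) <;> simp [H.hy.le, H.hz.le]
  exact mul_nonneg hswt (zero_le_one.trans (one_le_ΦY H _ hr _))

/-- A geometric envelope under the two-fugacity weights: if `m·t^{κN} ≤ C/x^N` with `m ≥ 0` and `x t^κ μ_1 > 1`, then
`m/C_{1,N}(y,z) ≤ C·K(y)K(z)·θ^N` for `N ≥ 1`, `θ = (x t^κ μ_1)⁻¹` (Fekete: `μ_1^N ≤ K(y)K(z)·C_{1,N}`).
[cite: BeatonBousquetMelouDeGierDuminilCopinGuttmann2014, §3.2 Proposition 6 (arXiv v5 p. 10: μ_T(y,z) = lim C_{T,n}^{1/n})] -/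
theorem weighted_fraction_le_geometric (hy : 0 < y) (hz : 0 < z) {m C t x κ : ℝ} {N : ℕ} (hN : N ≠ 0) (hm : 0 ≤ m)
    (ht : 0 < t) (hx : 0 < x) (h : m * t ^ (κ * N) ≤ C / x ^ N) :
    m / stripZ₂ 1 N y z ≤ C * (yK y * yK z) * ((x * t ^ κ * stripMuY₂ 1 y z)⁻¹) ^ N := by
  set μ := stripMuY₂ 1 y z with hμ
  have hμ0 : 0 < μ := stripMuY₂_pos 1 hy hz
  have hZ : 0 < stripZ₂ 1 N y z := stripZ₂_pos 1 N hy hz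
  have hK : 1 ≤ yK y * yK z := one_le_mul_of_one_le_of_one_le (one_le_yK y) (one_le_yK z)
  have hfek : μ ^ N ≤ yK y * yK z * stripZ₂ 1 N y z := stripMuY₂_one_pow_le hy hz hN
  have hμN : 0 < μ ^ N := pow_pos hμ0 N
  have hxN : 0 < x ^ N := pow_pos hx N
  have htN : 0 < t ^ (κ * N) := Real.rpow_pos_of_pos ht _
  have hC : 0 ≤ C := by
    have : 0 ≤ C / x ^ N := le_trans (mul_nonneg hm htN.le) h
    rwa [le_div_iff₀ hxN, zero_mul] at this
  have h' : m ≤ C / (x ^ N * t ^ (κ * N)) := by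
    rw [le_div_iff₀ (mul_pos hxN htN)]
    calc m * (x ^ N * t ^ (κ * N)) = m * t ^ (κ * N) * x ^ N := by ring
      _ ≤ C / x ^ N * x ^ N := by gcongr
      _ = C := div_mul_cancel₀ _ hxN.ne'
  have e : C * (yK y * yK z) * ((x * t ^ κ * μ)⁻¹) ^ N = C / (x ^ N * t ^ (κ * N)) * ((yK y * yK z) / μ ^ N) := by
    rw [inv_pow, mul_pow, mul_pow, ← Real.rpow_mul_natCast ht.le]; field_simp
  rw [e]
  -- `m / Z ≤ m · (K/μ^N)` since `μ^N ≤ K Z`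
  have hZ' : 1 / stripZ₂ 1 N y z ≤ (yK y * yK z) / μ ^ N := by
    rw [div_le_div_iff₀ hZ hμN, one_mul]; linarith
  calc m / stripZ₂ 1 N y z = m * (1 / stripZ₂ 1 N y z) := by ring
    _ ≤ C / (x ^ N * t ^ (κ * N)) * ((yK y * yK z) / μ ^ N) :=
        mul_le_mul h' hZ' (by positivity) (le_trans hm h')

open Classical in
/-- ★★★ **THE UPPER TAIL OF THE DEFICIT IS EXPONENTIALLY SMALL UNDER THE TWO-FUGACITY MEASURE**: for every `y, z > 0` and
every `κ > ρ(y,z)` there are `C` and `θ < 1` with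
`Σ_{ω ∈ S_N(S_1), N − |X(ω)| ≥ κN} y^{bc(ω)} z^{tc(ω)} ≤ C θ^N · C_{1,N}(y,z)` for all `N ≥ 1`.
[cite: BeatonBousquetMelouDeGierDuminilCopinGuttmann2014, §3.2 Proposition 6 (arXiv v5 p. 10); AlmJanson1990, via MadrasSlade1993 §8.5 pp. 278–279] -/
theorem twoWall_deficit_ge_fraction_le (hy : 0 < y) (hz : 0 < z) {κ : ℝ}
    (hκ : twoWallRho y z < κ) :
    ∃ C θ : ℝ, 0 ≤ C ∧ 0 ≤ θ ∧ θ < 1 ∧ ∀ N : ℕ, N ≠ 0 →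
      (∑ q ∈ (stripPairs 1 N).filter (fun q => κ * N ≤ (N : ℝ) - |(q.2 N 0 : ℝ)|), wgt y z N q) / stripZ₂ 1 N y z ≤ C * θ ^ N := by
  classical
  obtain ⟨hyx, hzx, hM, hsex⟩ := twoWall_critical_facts hy hz
  obtain ⟨hys, hzs⟩ := lt_stripMuY₂_one_sq₂ hy hz
  have hκM : 1 < κ * twoWallM y z := by
    unfold twoWallRho at hκ; exact (div_lt_iff₀ hM).1 hκ
  obtain ⟨t, x, ht1, H, hval⟩ := exists_tiltY_gt hy hz (stripMuY₂_pos 1 hy hz) hys hzs hsex (κ := κ) (by unfold twoWallM at hκM; exact hκM)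
  have ht0 : 0 < t := zero_lt_one.trans ht1
  refine ⟨startConst y z t x * (yK y * yK z), (x * t ^ κ * stripMuY₂ 1 y z)⁻¹,
    mul_nonneg (startConst_nonneg H) (zero_le_one.trans (one_le_mul_of_one_le_of_one_le (one_le_yK y) (one_le_yK z))),
    inv_nonneg.2 (zero_le_one.trans hval.le), inv_lt_one_of_one_lt₀ hval, fun N hN => ?_⟩
  exact weighted_fraction_le_geometric hy hz hN (Finset.sum_nonneg fun q _ => wgt_nonneg hy.le hz.le N q) ht0 H.hx0
    (sum_wgt_deficit_ge_le H ht1.le N κ)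

open Classical in
/-- ★★★ **THE LOWER TAIL OF THE DEFICIT IS EXPONENTIALLY SMALL UNDER THE TWO-FUGACITY MEASURE**: for `κ < ρ(y,z)` there are `C`,
`θ < 1` with `Σ_{ω : N − |X(ω)| ≤ κN} y^{bc} z^{tc} ≤ C θ^N · C_{1,N}(y,z)` (`N ≥ 1`).
[cite: BeatonBousquetMelouDeGierDuminilCopinGuttmann2014, §3.2 Proposition 6 (arXiv v5 p. 10); AlmJanson1990, via MadrasSlade1993 §8.5 pp. 278–279] -/
theorem twoWall_deficit_le_fraction_le (hy : 0 < y) (hz : 0 < z) {κ : ℝ}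
    (hκ : κ < twoWallRho y z) :
    ∃ C θ : ℝ, 0 ≤ C ∧ 0 ≤ θ ∧ θ < 1 ∧ ∀ N : ℕ, N ≠ 0 →
      (∑ q ∈ (stripPairs 1 N).filter (fun q => (N : ℝ) - |(q.2 N 0 : ℝ)| ≤ κ * N), wgt y z N q) / stripZ₂ 1 N y z ≤ C * θ ^ N := by
  classical
  obtain ⟨hyx, hzx, hM, hsex⟩ := twoWall_critical_facts hy hz
  obtain ⟨hys, hzs⟩ := lt_stripMuY₂_one_sq₂ hy hz
  have hκM : κ * twoWallM y z < 1 := by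
    unfold twoWallRho at hκ; rwa [lt_div_iff₀ hM] at hκ
  obtain ⟨t, x, ht0, ht1, H, hval⟩ := exists_tiltY_lt hy hz (stripMuY₂_pos 1 hy hz) hys hzs hsex (κ := κ) (by unfold twoWallM at hκM; exact hκM)
  refine ⟨startConst y z t x * (yK y * yK z), (x * t ^ κ * stripMuY₂ 1 y z)⁻¹,
    mul_nonneg (startConst_nonneg H) (zero_le_one.trans (one_le_mul_of_one_le_of_one_le (one_le_yK y) (one_le_yK z))),
    inv_nonneg.2 (zero_le_one.trans hval.le), inv_lt_one_of_one_lt₀ hval, fun N hN => ?_⟩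
  exact weighted_fraction_le_geometric hy hz hN (Finset.sum_nonneg fun q _ => wgt_nonneg hy.le hz.le N q) ht0 H.hx0
    (sum_wgt_deficit_le_le H ht0 ht1.le N κ)

open Classical in
/-- **The speed-deviation event under the two-fugacity measure**: `| |X(ω)|/N − v(y,z) | ≥ ε`.
[cite: MadrasSlade1993, §1.1 eq. (1.1.5); BeatonBousquetMelouDeGierDuminilCopinGuttmann2014, §3.2] -/
def twoWallSpeedDevPairs (y z : ℝ) (N : ℕ) (ε : ℝ) : Finset (Site 2 × (ℕ → Site 2)) :=
  (stripPairs 1 N).filter fun q => ε ≤ |(|(q.2 N 0 : ℝ)|) / N - twoWallSpeed y z|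

open Classical in
/-- A speed deviation is a deficit deviation (two walls). [cite: MadrasSlade1993, §1.1 eq. (1.1.5)] -/
theorem twoWallSpeedDevPairs_subset {N : ℕ} (hN : 1 ≤ N) (ε : ℝ) :
    twoWallSpeedDevPairs y z N ε ⊆
      ((stripPairs 1 N).filter fun q => (twoWallRho y z + ε) * N ≤ (N : ℝ) - |(q.2 N 0 : ℝ)|) ∪
      ((stripPairs 1 N).filter fun q => (N : ℝ) - |(q.2 N 0 : ℝ)| ≤ (twoWallRho y z - ε) * N) := by
  intro q hq
  rw [twoWallSpeedDevPairs, Finset.mem_filter, twoWallSpeed] at hq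
  obtain ⟨hq, hε⟩ := hq
  set ρ := twoWallRho y z
  set X := |(q.2 N 0 : ℝ)|
  have hN' : (0 : ℝ) < N := by exact_mod_cast hN
  have e : X / N - (1 - ρ) = ρ - (N - X) / N := by field_simp; ring
  rw [e] at hε
  rw [Finset.mem_union, Finset.mem_filter, Finset.mem_filter]
  rcases le_abs'.1 hε with h | h
  · left; refine ⟨hq, ?_⟩
    have h' : ρ + ε ≤ (N - X) / N := by linarith
    rw [le_div_iff₀ hN'] at h'; exact h'
  · right; refine ⟨hq, ?_⟩
    have h' : (N - X) / N ≤ ρ - ε := by linarith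
    rw [div_le_iff₀ hN'] at h'; exact h'

open Classical in
/-- ★★★ **THE TWO-WALL SPEED LAW (law of large numbers under `P_{N,y,z}`)**: for every `y, z > 0` and every `ε > 0`, `P_{N,y,z}(| |X(ω)|/N − v(y,z) | ≥ ε) = Σ_{dev} y^{bc} z^{tc} / C_{1,N}(y,z) → 0`, where
`v(y,z) = 1 − ρ(y,z) = 1 − yz x₀⁴/(y(1 − zx₀²) + z(1 − yx₀²) + 3yz x₀⁴)`, `x₀ = 1/μ_1(y,z)` (`μ_1(y,z)²` the largest root of the
sextic `s(s − y)(s − z) = yz`). At `y = z = 1` this is `v = 2(μ+1)/(2μ+3)` (`HexBW.tendsto_speedDevFraction`).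
[cite: BeatonBousquetMelouDeGierDuminilCopinGuttmann2014, §3.2 Proposition 6 (arXiv v5 p. 10); AlmJanson1990, via MadrasSlade1993 §8.5 pp. 278–279; MadrasSlade1993, §1.1 eq. (1.1.5)] -/
theorem tendsto_twoWallSpeedDevFraction (hy : 0 < y) (hz : 0 < z) {ε : ℝ} (hε : 0 < ε) :
    Tendsto (fun N => (∑ q ∈ twoWallSpeedDevPairs y z N ε, wgt y z N q) / stripZ₂ 1 N y z) atTop (𝓝 0) := by
  classical
  set ρ := twoWallRho y z with hρ
  obtain ⟨C₁, θ₁, hC₁, hθ₁, hθ₁1, h₁⟩ := twoWall_deficit_ge_fraction_le hy hz (κ := ρ + ε) (by linarith)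
  obtain ⟨C₂, θ₂, hC₂, hθ₂, hθ₂1, h₂⟩ := twoWall_deficit_le_fraction_le hy hz (κ := ρ - ε) (by linarith)
  have hlim : Tendsto (fun N : ℕ => C₁ * θ₁ ^ N + C₂ * θ₂ ^ N) atTop (𝓝 0) := by
    have := ((tendsto_pow_atTop_nhds_zero_of_lt_one hθ₁ hθ₁1).const_mul C₁).add
      ((tendsto_pow_atTop_nhds_zero_of_lt_one hθ₂ hθ₂1).const_mul C₂)
    simpa using this
  have hZ : ∀ N, 0 < stripZ₂ 1 N y z := fun N => stripZ₂_pos 1 N hy hz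
  refine squeeze_zero' (Eventually.of_forall fun N => div_nonneg
    (Finset.sum_nonneg fun q _ => wgt_nonneg hy.le hz.le N q) (hZ N).le) ?_ hlim
  filter_upwards [eventually_ge_atTop 1] with N hN
  have hN0 : N ≠ 0 := by omega
  calc (∑ q ∈ twoWallSpeedDevPairs y z N ε, wgt y z N q) / stripZ₂ 1 N y z
      ≤ ((∑ q ∈ (stripPairs 1 N).filter (fun q => (ρ + ε) * N ≤ (N : ℝ) - |(q.2 N 0 : ℝ)|), wgt y z N q) +
          (∑ q ∈ (stripPairs 1 N).filter (fun q => (N : ℝ) - |(q.2 N 0 : ℝ)| ≤ (ρ - ε) * N), wgt y z N q)) /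
          stripZ₂ 1 N y z := by
        gcongr
        · exact (hZ N).le
        calc ∑ q ∈ twoWallSpeedDevPairs y z N ε, wgt y z N q
            ≤ ∑ q ∈ ((stripPairs 1 N).filter (fun q => (ρ + ε) * N ≤ (N : ℝ) - |(q.2 N 0 : ℝ)|)) ∪
                ((stripPairs 1 N).filter (fun q => (N : ℝ) - |(q.2 N 0 : ℝ)| ≤ (ρ - ε) * N)), wgt y z N q :=
              Finset.sum_le_sum_of_subset_of_nonneg (twoWallSpeedDevPairs_subset hN ε) fun q _ _ => wgt_nonneg hy.le hz.le N q
          _ ≤ _ := by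
              rw [← Finset.sum_union_inter]
              linarith [Finset.sum_nonneg (s := ((stripPairs 1 N).filter (fun q => (ρ + ε) * N ≤ (N : ℝ) - |(q.2 N 0 : ℝ)|)) ∩
                ((stripPairs 1 N).filter (fun q => (N : ℝ) - |(q.2 N 0 : ℝ)| ≤ (ρ - ε) * N)))
                (fun q _ => wgt_nonneg hy.le hz.le N q)]
    _ = _ := add_div _ _ _
    _ ≤ C₁ * θ₁ ^ N + C₂ * θ₂ ^ N := add_le_add (h₁ N hN0) (h₂ N hN0)


end pairsY

namespace WidthOne

open LState WidthOneYZ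

/-! ## §8 The rung count alone under the two-fugacity weights (`s = 1`): `V(ω)/N → ρ(y,z)`, back steps `o(N)` -/

/-- The potential hypotheses with `s = 1` follow from those with any `s`. [cite: Stanley2012EC1, §4.7 (lane plumbing)] -/
theorem PotHyp.to_one {y z t s x : ℝ} (H : PotHyp y z t s x) : PotHyp y z t 1 x where
  hx0 := H.hx0
  hy := H.hy
  hz := H.hz
  ht := H.ht
  hs := zero_le_one
  hssy := by have := H.hay; have := H.hx0; nlinarith
  hssz := by have := H.haz; have := H.hx0; nlinarith
  hay := H.hay
  haz := H.haz
  hD := H.hD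

variable {y z t x : ℝ}

/-- ★ Weighted tilted rung sum: `Σ_{w ∈ acc N} wprod(a,w)·t^{nV w} ≤ ΦY(t,1,x)(start)/x^N`. [cite: Stanley2012EC1, §4.7 (transfer-matrix method with weights)] -/
theorem sum_wprod_pow_nV_le (H : PotHyp y z t 1 x) (p : ℕ) {a : Site 2} (hp : Cons p start (par (a 0)))
    (hr0 : a 1 = 0 ∨ a 1 = 1) (N : ℕ) :
    ∑ w ∈ acc p ⟨start, 0, a 1⟩ N, wprod y z a w * t ^ nV w ≤ ΦY y z t 1 x start (a 1) (par (a 0)) / x ^ N := by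
  have hx0 := H.hx0
  rw [le_div_iff₀ (pow_pos hx0 N)]
  have h := sum_acc_weightY_mul_pow_le H p N ⟨start, 0, a 1⟩ a (by simp [HOk]) (by simpa using hr0) rfl hp
  simp only [one_pow, mul_one] at h
  exact h

/-- ★ Chernoff for the weighted rung count, upper tail (`t ≥ 1`). [cite: Stanley2012EC1, §4.7 (transfer-matrix method with weights)] -/
theorem sum_wprod_nV_ge_mul_rpow_le (H : PotHyp y z t 1 x) (ht1 : 1 ≤ t) (p : ℕ) {a : Site 2}
    (hp : Cons p start (par (a 0))) (hr0 : a 1 = 0 ∨ a 1 = 1) (N : ℕ) (κ : ℝ) :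
    (∑ w ∈ (acc p ⟨start, 0, a 1⟩ N).filter (fun w => κ ≤ nV w), wprod y z a w) * t ^ κ ≤
      ΦY y z t 1 x start (a 1) (par (a 0)) / x ^ N := by
  classical
  have hy := H.hy.le; have hz := H.hz.le
  have ht0 : 0 ≤ t := zero_le_one.trans ht1
  rw [Finset.sum_mul]
  calc ∑ w ∈ (acc p ⟨start, 0, a 1⟩ N).filter (fun w => κ ≤ nV w), wprod y z a w * t ^ κ
      ≤ ∑ w ∈ (acc p ⟨start, 0, a 1⟩ N).filter (fun w => κ ≤ nV w), wprod y z a w * t ^ nV w :=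
        Finset.sum_le_sum fun w hw => by
          have hκ := (Finset.mem_filter.1 hw).2
          refine mul_le_mul_of_nonneg_left ?_ (wprod_nonneg hy hz a w)
          calc t ^ κ ≤ t ^ (nV w : ℝ) := Real.rpow_le_rpow_of_exponent_le ht1 hκ
            _ = t ^ nV w := Real.rpow_natCast t _
    _ ≤ ∑ w ∈ acc p ⟨start, 0, a 1⟩ N, wprod y z a w * t ^ nV w :=
        Finset.sum_le_sum_of_subset_of_nonneg (Finset.filter_subset _ _) fun w _ _ =>
          mul_nonneg (wprod_nonneg hy hz a w) (pow_nonneg ht0 _)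
    _ ≤ _ := sum_wprod_pow_nV_le H p hp hr0 N

/-- ★ Chernoff for the weighted rung count, lower tail (`0 < t ≤ 1`). [cite: Stanley2012EC1, §4.7 (transfer-matrix method with weights)] -/
theorem sum_wprod_nV_le_mul_rpow_le (H : PotHyp y z t 1 x) (ht0 : 0 < t) (ht1 : t ≤ 1) (p : ℕ) {a : Site 2}
    (hp : Cons p start (par (a 0))) (hr0 : a 1 = 0 ∨ a 1 = 1) (N : ℕ) (κ : ℝ) :
    (∑ w ∈ (acc p ⟨start, 0, a 1⟩ N).filter (fun w => (nV w : ℝ) ≤ κ), wprod y z a w) * t ^ κ ≤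
      ΦY y z t 1 x start (a 1) (par (a 0)) / x ^ N := by
  classical
  have hy := H.hy.le; have hz := H.hz.le
  rw [Finset.sum_mul]
  calc ∑ w ∈ (acc p ⟨start, 0, a 1⟩ N).filter (fun w => (nV w : ℝ) ≤ κ), wprod y z a w * t ^ κ
      ≤ ∑ w ∈ (acc p ⟨start, 0, a 1⟩ N).filter (fun w => (nV w : ℝ) ≤ κ), wprod y z a w * t ^ nV w :=
        Finset.sum_le_sum fun w hw => by
          have hκ := (Finset.mem_filter.1 hw).2
          refine mul_le_mul_of_nonneg_left ?_ (wprod_nonneg hy hz a w)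
          calc t ^ κ ≤ t ^ (nV w : ℝ) := Real.rpow_le_rpow_of_exponent_ge ht0 ht1 hκ
            _ = t ^ nV w := Real.rpow_natCast t _
    _ ≤ ∑ w ∈ acc p ⟨start, 0, a 1⟩ N, wprod y z a w * t ^ nV w :=
        Finset.sum_le_sum_of_subset_of_nonneg (Finset.filter_subset _ _) fun w _ _ =>
          mul_nonneg (wprod_nonneg hy hz a w) (pow_nonneg ht0.le _)
    _ ≤ _ := sum_wprod_pow_nV_le H p hp hr0 N

end WidthOne

section pairsY2

open WidthOne WidthOne.LState WidthOneYZ WallPot LadderPot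

variable {y z : ℝ}

open Classical in
/-- **The weighted fibre of a rung-count event** over a starting site is the weighted word sum with that rung count
(bridge `ladderPot_nV_traj`). [cite: BeatonBousquetMelouDeGierDuminilCopinGuttmann2014, §3.2 (arXiv v5 p. 10); MadrasSlade1993, §8.2 eq. (8.2.1)] -/
theorem sum_filter_wgt_rungs_eq (N : ℕ) (P : ℝ → Prop) [DecidablePred P] {a : Site 2} (ha : a ∈ stripStarts 1) :
    ∑ q ∈ (stripPairs 1 N).filter (fun q => P (LadderPot.nV q N) ∧ q.1 = a), wgt y z N q =
      swt y z a * ∑ w ∈ (acc (a 0).toNat ⟨start, 0, a 1⟩ N).filter (fun w => P (nV w)), wprod y z a w := by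
  classical
  obtain ⟨⟨ha0, ha0'⟩, ha1, ha1'⟩ := mem_stripStarts.1 ha
  have hfilt : (stripPairs 1 N).filter (fun q => P (LadderPot.nV q N) ∧ q.1 = a) =
      ((stripPairs 1 N).filter (fun q => q.1 = a)).filter (fun q => P (LadderPot.nV q N)) := by
    rw [Finset.filter_filter]; congr 1; ext q; exact and_comm
  rw [hfilt, filter_stripPairs_eq N ha, Finset.filter_image, Finset.sum_image]
  swap
  · intro w hw w' hw' h
    simp only [Finset.mem_coe, Finset.mem_filter, acc, mem_words] at hw hw'
    simp only [Prod.mk.injEq, true_and] at h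
    exact eq_of_traj_eq (hw.1.1.trans hw'.1.1.symm) h
  rw [Finset.mul_sum]
  have hset : (acc (a 0).toNat (startG a) N).filter (fun w => P (LadderPot.nV (a, traj w) N)) =
      (acc (a 0).toNat ⟨start, 0, a 1⟩ N).filter (fun w => P (nV w)) := by
    ext w
    simp only [Finset.mem_filter, acc, mem_words, startG]
    constructor
    · rintro ⟨hw, hP⟩; exact ⟨hw, by rwa [← hw.1, ladderPot_nV_traj] at hP⟩
    · rintro ⟨hw, hP⟩; exact ⟨hw, by rw [← hw.1, ladderPot_nV_traj]; exact hP⟩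
  rw [hset]
  refine Finset.sum_congr rfl fun w hw => ?_
  simp only [Finset.mem_filter, acc, mem_words] at hw
  have hgood : Good a w := (good_iff_isSome (p := (a 0).toNat) (Int.toNat_of_nonneg ha0).symm
    (by push_cast at ha1'; omega) w).2 hw.1.2
  unfold wgt
  rw [← hw.1.1, pow_visits_eq_prod, prod_swt_traj]
  intro m hm
  have := hgood.2.2 m hm
  simp only [InStrip, Nat.cast_one] at this
  show (a + traj w m) 1 = 0 ∨ (a + traj w m) 1 = 1
  omega

/-- The constant of the rung-count Chernoff bound: `Σ_{a ∈ starts} swt(a)·ΦY(t,1,x)(start, a₁, par a₀)`. [cite: Stanley2012EC1, §4.7 (lane plumbing)] -/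
def startConst₁ (y z t x : ℝ) : ℝ := ∑ a ∈ stripStarts 1, swt y z a * ΦY y z t 1 x start (a 1) (par (a 0))

/-- `startConst₁ ≥ 0`. [cite: Stanley2012EC1, §4.7 (lane plumbing)] -/
theorem startConst₁_nonneg {t x : ℝ} (H : PotHyp y z t 1 x) : 0 ≤ startConst₁ y z t x := by
  unfold startConst₁
  refine Finset.sum_nonneg fun a ha => ?_
  obtain ⟨-, ha1, ha1'⟩ := mem_stripStarts.1 ha
  have hr : a 1 = 0 ∨ a 1 = 1 := by simp only [Nat.cast_one] at ha1'; omega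
  have hswt : 0 ≤ swt y z a := by
    unfold swt wρ; cases par (a 0) <;> cases decide (a 1 = 1) <;> simp [H.hy.le, H.hz.le]
  exact mul_nonneg hswt (zero_le_one.trans (one_le_ΦY H _ hr _))

open Classical in
/-- ★★ Chernoff for the weighted walks' rung count, upper tail. [cite: Stanley2012EC1, §4.7 (transfer-matrix method with weights); BeatonBousquetMelouDeGierDuminilCopinGuttmann2014, §3.2] -/
theorem sum_wgt_rungs_ge_le {t x : ℝ} (H : PotHyp y z t 1 x) (ht1 : 1 ≤ t) (N : ℕ) (κ : ℝ) :
    (∑ q ∈ (stripPairs 1 N).filter (fun q => κ * N ≤ (LadderPot.nV q N : ℝ)), wgt y z N q) * t ^ (κ * N) ≤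
      startConst₁ y z t x / x ^ N := by
  classical
  have hdecomp : ∑ q ∈ (stripPairs 1 N).filter (fun q => κ * N ≤ (LadderPot.nV q N : ℝ)), wgt y z N q =
      ∑ a ∈ stripStarts 1, ∑ q ∈ (stripPairs 1 N).filter (fun q => (κ * N ≤ (LadderPot.nV q N : ℝ)) ∧ q.1 = a), wgt y z N q := by
    rw [← Finset.sum_fiberwise_of_maps_to (s := (stripPairs 1 N).filter (fun q => κ * N ≤ (LadderPot.nV q N : ℝ)))
      (t := stripStarts 1) (g := Prod.fst) (fun q hq => (mem_stripPairs.1 (Finset.mem_filter.1 hq).1).1)]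
    refine Finset.sum_congr rfl fun a _ => ?_
    rw [Finset.filter_filter]
  rw [hdecomp, Finset.sum_mul, startConst₁, Finset.sum_div]
  refine Finset.sum_le_sum fun a ha => ?_
  obtain ⟨⟨ha0, ha0'⟩, ha1, ha1'⟩ := mem_stripStarts.1 ha
  have hr : a 1 = 0 ∨ a 1 = 1 := by simp only [Nat.cast_one] at ha1'; omega
  rw [sum_filter_wgt_rungs_eq N (fun d => κ * N ≤ d) ha, mul_assoc, mul_div_assoc]
  have hswt : 0 ≤ swt y z a := by
    unfold swt wρ; cases par (a 0) <;> cases decide (a 1 = 1) <;> simp [H.hy.le, H.hz.le]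
  refine mul_le_mul_of_nonneg_left ?_ hswt
  have := sum_wprod_nV_ge_mul_rpow_le H ht1 (a 0).toNat (cons_start_site ha) hr N (κ * N)
  simpa using this

open Classical in
/-- ★★ Chernoff for the weighted walks' rung count, lower tail. [cite: Stanley2012EC1, §4.7 (transfer-matrix method with weights); BeatonBousquetMelouDeGierDuminilCopinGuttmann2014, §3.2] -/
theorem sum_wgt_rungs_le_le {t x : ℝ} (H : PotHyp y z t 1 x) (ht0 : 0 < t) (ht1 : t ≤ 1) (N : ℕ) (κ : ℝ) :
    (∑ q ∈ (stripPairs 1 N).filter (fun q => (LadderPot.nV q N : ℝ) ≤ κ * N), wgt y z N q) * t ^ (κ * N) ≤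
      startConst₁ y z t x / x ^ N := by
  classical
  have hdecomp : ∑ q ∈ (stripPairs 1 N).filter (fun q => (LadderPot.nV q N : ℝ) ≤ κ * N), wgt y z N q =
      ∑ a ∈ stripStarts 1, ∑ q ∈ (stripPairs 1 N).filter (fun q => ((LadderPot.nV q N : ℝ) ≤ κ * N) ∧ q.1 = a), wgt y z N q := by
    rw [← Finset.sum_fiberwise_of_maps_to (s := (stripPairs 1 N).filter (fun q => (LadderPot.nV q N : ℝ) ≤ κ * N))
      (t := stripStarts 1) (g := Prod.fst) (fun q hq => (mem_stripPairs.1 (Finset.mem_filter.1 hq).1).1)]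
    refine Finset.sum_congr rfl fun a _ => ?_
    rw [Finset.filter_filter]
  rw [hdecomp, Finset.sum_mul, startConst₁, Finset.sum_div]
  refine Finset.sum_le_sum fun a ha => ?_
  obtain ⟨⟨ha0, ha0'⟩, ha1, ha1'⟩ := mem_stripStarts.1 ha
  have hr : a 1 = 0 ∨ a 1 = 1 := by simp only [Nat.cast_one] at ha1'; omega
  rw [sum_filter_wgt_rungs_eq N (fun d => d ≤ κ * N) ha, mul_assoc, mul_div_assoc]
  have hswt : 0 ≤ swt y z a := by
    unfold swt wρ; cases par (a 0) <;> cases decide (a 1 = 1) <;> simp [H.hy.le, H.hz.le]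
  refine mul_le_mul_of_nonneg_left ?_ hswt
  have := sum_wprod_nV_le_mul_rpow_le H ht0 ht1 (a 0).toNat (cons_start_site ha) hr N (κ * N)
  simpa using this

open Classical in
/-- ★★★ **THE UPPER TAIL OF THE RUNG COUNT UNDER THE TWO-FUGACITY MEASURE**: for `y, z > 0` and `κ > ρ(y,z)`,
`P_{N,y,z}(V(ω) ≥ κN) ≤ C θ^N` (`θ < 1`, `N ≥ 1`). [cite: BeatonBousquetMelouDeGierDuminilCopinGuttmann2014, §3.2 Proposition 6 (arXiv v5 p. 10); AlmJanson1990, via MadrasSlade1993 §8.5 pp. 278–279] -/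
theorem twoWall_rungs_ge_fraction_le (hy : 0 < y) (hz : 0 < z) {κ : ℝ}
    (hκ : twoWallRho y z < κ) :
    ∃ C θ : ℝ, 0 ≤ C ∧ 0 ≤ θ ∧ θ < 1 ∧ ∀ N : ℕ, N ≠ 0 →
      (∑ q ∈ (stripPairs 1 N).filter (fun q => κ * N ≤ (LadderPot.nV q N : ℝ)), wgt y z N q) / stripZ₂ 1 N y z ≤ C * θ ^ N := by
  classical
  obtain ⟨hyx, hzx, hM, hsex⟩ := twoWall_critical_facts hy hz
  obtain ⟨hys, hzs⟩ := lt_stripMuY₂_one_sq₂ hy hz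
  have hκM : 1 < κ * twoWallM y z := by unfold twoWallRho at hκ; exact (div_lt_iff₀ hM).1 hκ
  obtain ⟨t, x, ht1, H, hval⟩ := exists_tiltY_gt hy hz (stripMuY₂_pos 1 hy hz) hys hzs hsex (κ := κ) (by unfold twoWallM at hκM; exact hκM)
  have H1 := H.to_one
  have ht0 : 0 < t := zero_lt_one.trans ht1
  refine ⟨startConst₁ y z t x * (yK y * yK z), (x * t ^ κ * stripMuY₂ 1 y z)⁻¹,
    mul_nonneg (startConst₁_nonneg H1) (zero_le_one.trans (one_le_mul_of_one_le_of_one_le (one_le_yK y) (one_le_yK z))),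
    inv_nonneg.2 (zero_le_one.trans hval.le), inv_lt_one_of_one_lt₀ hval, fun N hN => ?_⟩
  exact weighted_fraction_le_geometric hy hz hN (Finset.sum_nonneg fun q _ => wgt_nonneg hy.le hz.le N q) ht0 H.hx0
    (sum_wgt_rungs_ge_le H1 ht1.le N κ)

open Classical in
/-- ★★★ **THE LOWER TAIL OF THE RUNG COUNT UNDER THE TWO-FUGACITY MEASURE** (`κ < ρ(y,z)`).
[cite: BeatonBousquetMelouDeGierDuminilCopinGuttmann2014, §3.2 Proposition 6 (arXiv v5 p. 10); AlmJanson1990, via MadrasSlade1993 §8.5 pp. 278–279] -/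
theorem twoWall_rungs_le_fraction_le (hy : 0 < y) (hz : 0 < z) {κ : ℝ}
    (hκ : κ < twoWallRho y z) :
    ∃ C θ : ℝ, 0 ≤ C ∧ 0 ≤ θ ∧ θ < 1 ∧ ∀ N : ℕ, N ≠ 0 →
      (∑ q ∈ (stripPairs 1 N).filter (fun q => (LadderPot.nV q N : ℝ) ≤ κ * N), wgt y z N q) / stripZ₂ 1 N y z ≤ C * θ ^ N := by
  classical
  obtain ⟨hyx, hzx, hM, hsex⟩ := twoWall_critical_facts hy hz
  obtain ⟨hys, hzs⟩ := lt_stripMuY₂_one_sq₂ hy hz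
  have hκM : κ * twoWallM y z < 1 := by unfold twoWallRho at hκ; rwa [lt_div_iff₀ hM] at hκ
  obtain ⟨t, x, ht0, ht1, H, hval⟩ := exists_tiltY_lt hy hz (stripMuY₂_pos 1 hy hz) hys hzs hsex (κ := κ) (by unfold twoWallM at hκM; exact hκM)
  have H1 := H.to_one
  refine ⟨startConst₁ y z t x * (yK y * yK z), (x * t ^ κ * stripMuY₂ 1 y z)⁻¹,
    mul_nonneg (startConst₁_nonneg H1) (zero_le_one.trans (one_le_mul_of_one_le_of_one_le (one_le_yK y) (one_le_yK z))),
    inv_nonneg.2 (zero_le_one.trans hval.le), inv_lt_one_of_one_lt₀ hval, fun N hN => ?_⟩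
  exact weighted_fraction_le_geometric hy hz hN (Finset.sum_nonneg fun q _ => wgt_nonneg hy.le hz.le N q) ht0 H.hx0
    (sum_wgt_rungs_le_le H1 ht0 ht1.le N κ)

open Classical in
/-- ★★★ **THE TWO-WALL RUNG DENSITY**: under `P_{N,y,z}` (every `y, z > 0`), `V(ω)/N → ρ(y,z)` in probability:
`P_{N,y,z}(|V(ω)/N − ρ(y,z)| ≥ ε) → 0` for every `ε > 0`. [cite: BeatonBousquetMelouDeGierDuminilCopinGuttmann2014, §3.2 Proposition 6 (arXiv v5 p. 10); AlmJanson1990, via MadrasSlade1993 §8.5 pp. 278–279] -/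
theorem tendsto_twoWallRungDevFraction (hy : 0 < y) (hz : 0 < z) {ε : ℝ} (hε : 0 < ε) :
    Tendsto (fun N => (∑ q ∈ (stripPairs 1 N).filter (fun q => ε ≤ |(LadderPot.nV q N : ℝ) / N - twoWallRho y z|), wgt y z N q) /
      stripZ₂ 1 N y z) atTop (𝓝 0) := by
  classical
  set ρ := twoWallRho y z with hρ
  obtain ⟨C₁, θ₁, hC₁, hθ₁, hθ₁1, h₁⟩ := twoWall_rungs_ge_fraction_le hy hz (κ := ρ + ε) (by linarith)
  obtain ⟨C₂, θ₂, hC₂, hθ₂, hθ₂1, h₂⟩ := twoWall_rungs_le_fraction_le hy hz (κ := ρ - ε) (by linarith)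
  have hlim : Tendsto (fun N : ℕ => C₁ * θ₁ ^ N + C₂ * θ₂ ^ N) atTop (𝓝 0) := by
    have := ((tendsto_pow_atTop_nhds_zero_of_lt_one hθ₁ hθ₁1).const_mul C₁).add
      ((tendsto_pow_atTop_nhds_zero_of_lt_one hθ₂ hθ₂1).const_mul C₂)
    simpa using this
  have hZ : ∀ N, 0 < stripZ₂ 1 N y z := fun N => stripZ₂_pos 1 N hy hz
  refine squeeze_zero' (Eventually.of_forall fun N => div_nonneg
    (Finset.sum_nonneg fun q _ => wgt_nonneg hy.le hz.le N q) (hZ N).le) ?_ hlim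
  filter_upwards [eventually_ge_atTop 1] with N hN
  have hN0 : N ≠ 0 := by omega
  have hN' : (0 : ℝ) < N := by exact_mod_cast hN
  have hsub : (stripPairs 1 N).filter (fun q => ε ≤ |(LadderPot.nV q N : ℝ) / N - ρ|) ⊆
      ((stripPairs 1 N).filter fun q => (ρ + ε) * N ≤ (LadderPot.nV q N : ℝ)) ∪
      ((stripPairs 1 N).filter fun q => (LadderPot.nV q N : ℝ) ≤ (ρ - ε) * N) := by
    intro q hq
    rw [Finset.mem_filter] at hq
    obtain ⟨hq, hdev⟩ := hq
    rw [Finset.mem_union, Finset.mem_filter, Finset.mem_filter]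
    rcases le_abs'.1 hdev with h | h
    · right; refine ⟨hq, ?_⟩
      have h' : (LadderPot.nV q N : ℝ) / N ≤ ρ - ε := by linarith
      rwa [div_le_iff₀ hN'] at h'
    · left; refine ⟨hq, ?_⟩
      have h' : ρ + ε ≤ (LadderPot.nV q N : ℝ) / N := by linarith
      rwa [le_div_iff₀ hN'] at h'
  calc (∑ q ∈ (stripPairs 1 N).filter (fun q => ε ≤ |(LadderPot.nV q N : ℝ) / N - ρ|), wgt y z N q) / stripZ₂ 1 N y z
      ≤ ((∑ q ∈ (stripPairs 1 N).filter (fun q => (ρ + ε) * N ≤ (LadderPot.nV q N : ℝ)), wgt y z N q) +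
          (∑ q ∈ (stripPairs 1 N).filter (fun q => (LadderPot.nV q N : ℝ) ≤ (ρ - ε) * N), wgt y z N q)) / stripZ₂ 1 N y z := by
        gcongr
        · exact (hZ N).le
        calc ∑ q ∈ (stripPairs 1 N).filter (fun q => ε ≤ |(LadderPot.nV q N : ℝ) / N - ρ|), wgt y z N q
            ≤ ∑ q ∈ ((stripPairs 1 N).filter fun q => (ρ + ε) * N ≤ (LadderPot.nV q N : ℝ)) ∪
                ((stripPairs 1 N).filter fun q => (LadderPot.nV q N : ℝ) ≤ (ρ - ε) * N), wgt y z N q :=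
              Finset.sum_le_sum_of_subset_of_nonneg hsub fun q _ _ => wgt_nonneg hy.le hz.le N q
          _ ≤ _ := by
              rw [← Finset.sum_union_inter]
              linarith [Finset.sum_nonneg (s := ((stripPairs 1 N).filter fun q => (ρ + ε) * N ≤ (LadderPot.nV q N : ℝ)) ∩
                ((stripPairs 1 N).filter fun q => (LadderPot.nV q N : ℝ) ≤ (ρ - ε) * N))
                (fun q _ => wgt_nonneg hy.le hz.le N q)]
    _ = _ := add_div _ _ _
    _ ≤ C₁ * θ₁ ^ N + C₂ * θ₂ ^ N := add_le_add (h₁ N hN0) (h₂ N hN0)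


open Classical in
/-- ★★ **THE BACK STEPS ARE NEGLIGIBLE UNDER `P_{N,y,z}`**: `N − |X(ω)| − V(ω)` (twice the back steps) exceeds `εN` only with
`P_{N,y,z}`-probability `→ 0`. [cite: MadrasSlade1993, §1.1 eq. (1.1.5); BeatonBousquetMelouDeGierDuminilCopinGuttmann2014, §3.2 (arXiv v5 p. 10)] -/
theorem tendsto_twoWallBackStepFraction (hy : 0 < y) (hz : 0 < z) {ε : ℝ} (hε : 0 < ε) :
    Tendsto (fun N => (∑ q ∈ (stripPairs 1 N).filter (fun q => ε * N ≤ (N : ℝ) - |(q.2 N 0 : ℝ)| - LadderPot.nV q N),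
      wgt y z N q) / stripZ₂ 1 N y z) atTop (𝓝 0) := by
  classical
  set ρ := twoWallRho y z with hρ
  obtain ⟨C₁, θ₁, hC₁, hθ₁, hθ₁1, h₁⟩ := twoWall_deficit_ge_fraction_le hy hz (κ := ρ + ε / 2) (by linarith)
  obtain ⟨C₂, θ₂, hC₂, hθ₂, hθ₂1, h₂⟩ := twoWall_rungs_le_fraction_le hy hz (κ := ρ - ε / 2) (by linarith)
  have hlim : Tendsto (fun N : ℕ => C₁ * θ₁ ^ N + C₂ * θ₂ ^ N) atTop (𝓝 0) := by
    have := ((tendsto_pow_atTop_nhds_zero_of_lt_one hθ₁ hθ₁1).const_mul C₁).add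
      ((tendsto_pow_atTop_nhds_zero_of_lt_one hθ₂ hθ₂1).const_mul C₂)
    simpa using this
  have hZ : ∀ N, 0 < stripZ₂ 1 N y z := fun N => stripZ₂_pos 1 N hy hz
  refine squeeze_zero' (Eventually.of_forall fun N => div_nonneg
    (Finset.sum_nonneg fun q _ => wgt_nonneg hy.le hz.le N q) (hZ N).le) ?_ hlim
  filter_upwards [eventually_ge_atTop 1] with N hN
  have hN0 : N ≠ 0 := by omega
  have hsub : ((stripPairs 1 N).filter fun q => ε * N ≤ (N : ℝ) - |(q.2 N 0 : ℝ)| - LadderPot.nV q N) ⊆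
      ((stripPairs 1 N).filter fun q => (ρ + ε / 2) * N ≤ (N : ℝ) - |(q.2 N 0 : ℝ)|) ∪
      ((stripPairs 1 N).filter fun q => (LadderPot.nV q N : ℝ) ≤ (ρ - ε / 2) * N) := by
    intro q hq
    rw [Finset.mem_filter] at hq
    obtain ⟨hq, hdev⟩ := hq
    rw [Finset.mem_union, Finset.mem_filter, Finset.mem_filter]
    by_cases h : (ρ + ε / 2) * N ≤ (N : ℝ) - |(q.2 N 0 : ℝ)|
    · exact Or.inl ⟨hq, h⟩
    · right; refine ⟨hq, ?_⟩
      have h' := not_le.1 h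
      nlinarith
  calc (∑ q ∈ (stripPairs 1 N).filter (fun q => ε * N ≤ (N : ℝ) - |(q.2 N 0 : ℝ)| - LadderPot.nV q N), wgt y z N q) /
        stripZ₂ 1 N y z
      ≤ ((∑ q ∈ (stripPairs 1 N).filter (fun q => (ρ + ε / 2) * N ≤ (N : ℝ) - |(q.2 N 0 : ℝ)|), wgt y z N q) +
          (∑ q ∈ (stripPairs 1 N).filter (fun q => (LadderPot.nV q N : ℝ) ≤ (ρ - ε / 2) * N), wgt y z N q)) / stripZ₂ 1 N y z := by
        gcongr
        · exact (hZ N).le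
        calc ∑ q ∈ (stripPairs 1 N).filter (fun q => ε * N ≤ (N : ℝ) - |(q.2 N 0 : ℝ)| - LadderPot.nV q N), wgt y z N q
            ≤ ∑ q ∈ ((stripPairs 1 N).filter fun q => (ρ + ε / 2) * N ≤ (N : ℝ) - |(q.2 N 0 : ℝ)|) ∪
                ((stripPairs 1 N).filter fun q => (LadderPot.nV q N : ℝ) ≤ (ρ - ε / 2) * N), wgt y z N q :=
              Finset.sum_le_sum_of_subset_of_nonneg hsub fun q _ _ => wgt_nonneg hy.le hz.le N q
          _ ≤ _ := by
              rw [← Finset.sum_union_inter]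
              linarith [Finset.sum_nonneg (s := ((stripPairs 1 N).filter fun q => (ρ + ε / 2) * N ≤ (N : ℝ) - |(q.2 N 0 : ℝ)|) ∩
                ((stripPairs 1 N).filter fun q => (LadderPot.nV q N : ℝ) ≤ (ρ - ε / 2) * N))
                (fun q _ => wgt_nonneg hy.le hz.le N q)]
    _ = _ := add_div _ _ _
    _ ≤ C₁ * θ₁ ^ N + C₂ * θ₂ ^ N := add_le_add (h₁ N hN0) (h₂ N hN0)

/-- **The mean end-to-end column distance under `P_{N,y,z}`**: `⟨|X(ω)|⟩_{N,y,z} = Σ_q wgt(q)·|X(q)| / C_{1,N}(y,z)`.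
[cite: MadrasSlade1993, §1.1 eq. (1.1.2), (1.1.5); BeatonBousquetMelouDeGierDuminilCopinGuttmann2014, §3.2 (arXiv v5 p. 10)] -/
def twoWallMeanAbsDisp (y z : ℝ) (N : ℕ) : ℝ := (∑ q ∈ stripPairs 1 N, wgt y z N q * |(q.2 N 0 : ℝ)|) / stripZ₂ 1 N y z

open Classical in
/-- ★★★ **THE MEAN SPEED UNDER `P_{N,y,z}`**: `⟨|X(ω)|⟩_{N,y,z} / N → v(y,z)` (every `y, z > 0`).
[cite: MadrasSlade1993, §1.1 eq. (1.1.5); BeatonBousquetMelouDeGierDuminilCopinGuttmann2014, §3.2 Proposition 6 (arXiv v5 p. 10); AlmJanson1990, via MadrasSlade1993 §8.5 pp. 278–279] -/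
theorem tendsto_twoWallMeanAbsDisp_div (hy : 0 < y) (hz : 0 < z) :
    Tendsto (fun N : ℕ => twoWallMeanAbsDisp y z N / N) atTop (𝓝 (twoWallSpeed y z)) := by
  classical
  set v := twoWallSpeed y z with hv
  have hZ : ∀ N, 0 < stripZ₂ 1 N y z := fun N => stripZ₂_pos 1 N hy hz
  -- `0 ≤ v ≤ 1`: `ρ = 1/M` with `M ≥ 3`
  obtain ⟨hyx, hzx, hM, -⟩ := twoWall_critical_facts hy hz
  have hM3 : 3 ≤ twoWallM y z := by
    unfold twoWallM
    have h1 : 0 ≤ y * (stripMuY₂ 1 y z)⁻¹ ^ 2 / (1 - y * (stripMuY₂ 1 y z)⁻¹ ^ 2) := div_nonneg (by positivity) (by linarith)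
    have h2 : 0 ≤ z * (stripMuY₂ 1 y z)⁻¹ ^ 2 / (1 - z * (stripMuY₂ 1 y z)⁻¹ ^ 2) := div_nonneg (by positivity) (by linarith)
    linarith
  have hρ0 : 0 ≤ twoWallRho y z := by unfold twoWallRho; positivity
  have hρ1 : twoWallRho y z ≤ 1 := by unfold twoWallRho; rw [div_le_one hM]; linarith
  have hv0 : 0 ≤ v := by rw [hv, twoWallSpeed]; linarith
  have hv1 : v ≤ 1 := by rw [hv, twoWallSpeed]; linarith
  rw [Metric.tendsto_atTop]
  intro η hη
  have h1 : ∀ᶠ N : ℕ in atTop, (∑ q ∈ twoWallSpeedDevPairs y z N (η / 2), wgt y z N q) / stripZ₂ 1 N y z < η / 2 :=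
    (tendsto_twoWallSpeedDevFraction hy hz (by positivity : 0 < η / 2)).eventually (gt_mem_nhds (by positivity))
  obtain ⟨N₀, hN₀⟩ := Filter.eventually_atTop.1 (h1.and (eventually_ge_atTop 1))
  refine ⟨N₀, fun N hN => ?_⟩
  obtain ⟨hA, hN1⟩ := hN₀ N hN
  have hN' : (0 : ℝ) < N := by exact_mod_cast hN1
  rw [Real.dist_eq]
  -- termwise: `|f_q − v| ≤ η/2 + [q ∈ dev]`, `f_q = |X(q)|/N ∈ [0,1]`
  have hterm : ∀ q ∈ stripPairs 1 N, wgt y z N q * |(|(q.2 N 0 : ℝ)|) / N - v| ≤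
      wgt y z N q * (η / 2) + (if q ∈ twoWallSpeedDevPairs y z N (η / 2) then wgt y z N q else 0) := by
    intro q hq
    have hw := wgt_nonneg hy.le hz.le N q
    have hf1 : |(q.2 N 0 : ℝ)| / N ≤ 1 := by rw [div_le_one hN']; exact (endpoint_bounds hq).1
    have hf0 : 0 ≤ |(q.2 N 0 : ℝ)| / N := by positivity
    split_ifs with h
    · have : |(|(q.2 N 0 : ℝ)|) / N - v| ≤ 1 := by rw [abs_le]; constructor <;> linarith
      nlinarith
    · have hsmall : |(|(q.2 N 0 : ℝ)|) / N - v| < η / 2 := by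
        by_contra hcon
        exact h (Finset.mem_filter.2 ⟨hq, not_lt.1 hcon⟩)
      nlinarith
  have hsum : ∑ q ∈ stripPairs 1 N, wgt y z N q * (|(q.2 N 0 : ℝ)| / N - v) =
      (∑ q ∈ stripPairs 1 N, wgt y z N q * |(q.2 N 0 : ℝ)|) / N - v * stripZ₂ 1 N y z := by
    rw [stripZ₂_one_eq_sum_wgt, Finset.mul_sum, Finset.sum_div, ← Finset.sum_sub_distrib]
    exact Finset.sum_congr rfl fun q _ => by ring
  have e : twoWallMeanAbsDisp y z N / N - v = (∑ q ∈ stripPairs 1 N, wgt y z N q * (|(q.2 N 0 : ℝ)| / N - v)) / stripZ₂ 1 N y z := by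
    rw [hsum, twoWallMeanAbsDisp]
    have hZ' := (hZ N).ne'
    field_simp
  rw [e, abs_div, abs_of_pos (hZ N), div_lt_iff₀ (hZ N)]
  calc |∑ q ∈ stripPairs 1 N, wgt y z N q * (|(q.2 N 0 : ℝ)| / N - v)|
      ≤ ∑ q ∈ stripPairs 1 N, |wgt y z N q * (|(q.2 N 0 : ℝ)| / N - v)| := Finset.abs_sum_le_sum_abs _ _
    _ = ∑ q ∈ stripPairs 1 N, wgt y z N q * |(|(q.2 N 0 : ℝ)|) / N - v| :=
        Finset.sum_congr rfl fun q _ => by rw [abs_mul, abs_of_nonneg (wgt_nonneg hy.le hz.le N q)]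
    _ ≤ ∑ q ∈ stripPairs 1 N, (wgt y z N q * (η / 2) + (if q ∈ twoWallSpeedDevPairs y z N (η / 2) then wgt y z N q else 0)) :=
        Finset.sum_le_sum hterm
    _ = (η / 2) * stripZ₂ 1 N y z + ∑ q ∈ twoWallSpeedDevPairs y z N (η / 2), wgt y z N q := by
        rw [Finset.sum_add_distrib, ← Finset.sum_mul, stripZ₂_one_eq_sum_wgt, Finset.sum_ite_mem, mul_comm]
        congr 2
        exact Finset.inter_eq_right.2 (show twoWallSpeedDevPairs y z N (η / 2) ⊆ stripPairs 1 N from Finset.filter_subset _ _)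
    _ < (η / 2) * stripZ₂ 1 N y z + (η / 2) * stripZ₂ 1 N y z := by
        have := (div_lt_iff₀ (hZ N)).1 hA; linarith
    _ = η * stripZ₂ 1 N y z := by ring

/-! ## §9 The mean-square displacement under `P_{N,y,z}`: `⟨‖ω(N)‖²⟩_{N,y,z}/N² → v(y,z)²` -/

open Zd

/-- **The mean-square end-to-end distance under `P_{N,y,z}`**: `⟨‖ω(N)‖²⟩_{N,y,z} = Σ_q wgt(q)‖q(N)‖² / C_{1,N}(y,z)` (M–S (1.1.2) for the
two-fugacity measure). [cite: MadrasSlade1993, §1.1 eq. (1.1.2), (1.1.5); BeatonBousquetMelouDeGierDuminilCopinGuttmann2014, §3.2 (arXiv v5 p. 10)] -/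
def twoWallMeanSqDisp (y z : ℝ) (N : ℕ) : ℝ := (∑ q ∈ stripPairs 1 N, wgt y z N q * euclidNorm (q.2 N) ^ 2) / stripZ₂ 1 N y z

open Classical in
/-- ★★★ **THE AMPLITUDE UNDER `P_{N,y,z}`**: `⟨‖ω(N)‖²⟩_{N,y,z} / N² → v(y,z)²` (every `y, z > 0`) — the law `⟨|ω(N)|²⟩ ∼ D N^{2ν}` of
(1.1.5) for the two-fugacity strip measure with `ν = 1` and the explicit amplitude `D = v(y,z)²`.
[cite: MadrasSlade1993, §1.1 eq. (1.1.2), (1.1.5); BeatonBousquetMelouDeGierDuminilCopinGuttmann2014, §3.2 Proposition 6 (arXiv v5 p. 10); AlmJanson1990, via MadrasSlade1993 §8.5 pp. 278–279] -/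
theorem tendsto_twoWallMeanSqDisp_div_sq (hy : 0 < y) (hz : 0 < z) :
    Tendsto (fun N : ℕ => twoWallMeanSqDisp y z N / (N : ℝ) ^ 2) atTop (𝓝 (twoWallSpeed y z ^ 2)) := by
  classical
  set v := twoWallSpeed y z with hv
  have hZ : ∀ N, 0 < stripZ₂ 1 N y z := fun N => stripZ₂_pos 1 N hy hz
  obtain ⟨hyx, hzx, hM, -⟩ := twoWall_critical_facts hy hz
  have hM3 : 3 ≤ twoWallM y z := by
    unfold twoWallM
    have h1 : 0 ≤ y * (stripMuY₂ 1 y z)⁻¹ ^ 2 / (1 - y * (stripMuY₂ 1 y z)⁻¹ ^ 2) := div_nonneg (by positivity) (by linarith)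
    have h2 : 0 ≤ z * (stripMuY₂ 1 y z)⁻¹ ^ 2 / (1 - z * (stripMuY₂ 1 y z)⁻¹ ^ 2) := div_nonneg (by positivity) (by linarith)
    linarith
  have hρ0 : 0 ≤ twoWallRho y z := by unfold twoWallRho; positivity
  have hρ1 : twoWallRho y z ≤ 1 := by unfold twoWallRho; rw [div_le_one hM]; linarith
  have hv0 : 0 ≤ v := by rw [hv, twoWallSpeed]; linarith
  have hv1 : v ≤ 1 := by rw [hv, twoWallSpeed]; linarith
  rw [Metric.tendsto_atTop]
  intro η hη
  have h1 : ∀ᶠ N : ℕ in atTop, (∑ q ∈ twoWallSpeedDevPairs y z N (η / 6), wgt y z N q) / stripZ₂ 1 N y z < η / 3 :=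
    (tendsto_twoWallSpeedDevFraction hy hz (by positivity : 0 < η / 6)).eventually (gt_mem_nhds (by positivity))
  have h2 : ∀ᶠ N : ℕ in atTop, 1 / (N : ℝ) < η / 3 :=
    tendsto_one_div_atTop_nhds_zero_nat.eventually (gt_mem_nhds (by positivity))
  obtain ⟨N₀, hN₀⟩ := Filter.eventually_atTop.1 (h1.and (h2.and (eventually_ge_atTop 1)))
  refine ⟨N₀, fun N hN => ?_⟩
  obtain ⟨hA, hB, hN1⟩ := hN₀ N hN
  have hN' : (0 : ℝ) < N := by exact_mod_cast hN1
  have hN2 : (0 : ℝ) < (N : ℝ) ^ 2 := by positivity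
  have hN1' : (1 : ℝ) ≤ N := by exact_mod_cast hN1
  have hC : 1 / (N : ℝ) ^ 2 ≤ 1 / (N : ℝ) :=
    div_le_div_of_nonneg_left zero_le_one hN' (by nlinarith)
  rw [Real.dist_eq]
  -- termwise bound
  have hterm : ∀ q ∈ stripPairs 1 N, wgt y z N q * |euclidNorm (q.2 N) ^ 2 / (N : ℝ) ^ 2 - v ^ 2| ≤
      wgt y z N q * (2 * (η / 6) + 1 / (N : ℝ) ^ 2) + (if q ∈ twoWallSpeedDevPairs y z N (η / 6) then wgt y z N q else 0) := by
    intro q hq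
    have hw := wgt_nonneg hy.le hz.le N q
    obtain ⟨hX, hY, hnorm⟩ := endpoint_bounds hq
    set X := |(q.2 N 0 : ℝ)| with hXd
    set u := X / N with hu
    have hu0 : 0 ≤ u := div_nonneg (abs_nonneg _) hN'.le
    have hu1 : u ≤ 1 := by rw [hu, div_le_one hN']; exact hX
    have hY2 : (q.2 N 1 : ℝ) ^ 2 ≤ 1 := by have := abs_le.1 hY; nlinarith
    have hdecomp : euclidNorm (q.2 N) ^ 2 / (N : ℝ) ^ 2 - v ^ 2 = (u ^ 2 - v ^ 2) + (q.2 N 1 : ℝ) ^ 2 / (N : ℝ) ^ 2 := by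
      rw [hnorm, hu, hXd, div_pow, sq_abs]; ring
    have hAu : |u ^ 2 - v ^ 2| ≤ 2 * |u - v| := by
      rw [show u ^ 2 - v ^ 2 = (u - v) * (u + v) by ring, abs_mul]
      calc |u - v| * |u + v| ≤ |u - v| * 2 :=
            mul_le_mul_of_nonneg_left (by rw [abs_of_nonneg (by linarith)]; linarith) (abs_nonneg _)
        _ = 2 * |u - v| := by ring
    have hAu' : |u ^ 2 - v ^ 2| ≤ 1 := by rw [abs_le]; constructor <;> nlinarith
    have hBu : |(q.2 N 1 : ℝ) ^ 2 / (N : ℝ) ^ 2| ≤ 1 / (N : ℝ) ^ 2 := by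
      rw [abs_of_nonneg (by positivity)]; gcongr
    have htri : |euclidNorm (q.2 N) ^ 2 / (N : ℝ) ^ 2 - v ^ 2| ≤ |u ^ 2 - v ^ 2| + |(q.2 N 1 : ℝ) ^ 2 / (N : ℝ) ^ 2| := by
      rw [hdecomp]; exact abs_add_le _ _
    split_ifs with hdev
    · have : |euclidNorm (q.2 N) ^ 2 / (N : ℝ) ^ 2 - v ^ 2| ≤ 1 + 1 / (N : ℝ) ^ 2 := by linarith
      have h2 := mul_le_mul_of_nonneg_left this hw
      have h3 : 0 ≤ wgt y z N q * (2 * (η / 6)) := by positivity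
      linarith [h2, h3]
    · have hsmall : |u - v| < η / 6 := by
        by_contra hcon
        exact hdev (Finset.mem_filter.2 ⟨hq, not_lt.1 hcon⟩)
      have : |euclidNorm (q.2 N) ^ 2 / (N : ℝ) ^ 2 - v ^ 2| ≤ 2 * (η / 6) + 1 / (N : ℝ) ^ 2 := by linarith
      have h2 := mul_le_mul_of_nonneg_left this hw
      linarith [h2]
  have hsum : ∑ q ∈ stripPairs 1 N, wgt y z N q * (euclidNorm (q.2 N) ^ 2 / (N : ℝ) ^ 2 - v ^ 2) =
      (∑ q ∈ stripPairs 1 N, wgt y z N q * euclidNorm (q.2 N) ^ 2) / (N : ℝ) ^ 2 - v ^ 2 * stripZ₂ 1 N y z := by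
    rw [stripZ₂_one_eq_sum_wgt, Finset.mul_sum, Finset.sum_div, ← Finset.sum_sub_distrib]
    exact Finset.sum_congr rfl fun q _ => by ring
  have e : twoWallMeanSqDisp y z N / (N : ℝ) ^ 2 - v ^ 2 =
      (∑ q ∈ stripPairs 1 N, wgt y z N q * (euclidNorm (q.2 N) ^ 2 / (N : ℝ) ^ 2 - v ^ 2)) / stripZ₂ 1 N y z := by
    rw [hsum, twoWallMeanSqDisp]
    have hZ' := (hZ N).ne'
    field_simp
  rw [e, abs_div, abs_of_pos (hZ N), div_lt_iff₀ (hZ N)]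
  calc |∑ q ∈ stripPairs 1 N, wgt y z N q * (euclidNorm (q.2 N) ^ 2 / (N : ℝ) ^ 2 - v ^ 2)|
      ≤ ∑ q ∈ stripPairs 1 N, |wgt y z N q * (euclidNorm (q.2 N) ^ 2 / (N : ℝ) ^ 2 - v ^ 2)| := Finset.abs_sum_le_sum_abs _ _
    _ = ∑ q ∈ stripPairs 1 N, wgt y z N q * |euclidNorm (q.2 N) ^ 2 / (N : ℝ) ^ 2 - v ^ 2| :=
        Finset.sum_congr rfl fun q _ => by rw [abs_mul, abs_of_nonneg (wgt_nonneg hy.le hz.le N q)]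
    _ ≤ ∑ q ∈ stripPairs 1 N, (wgt y z N q * (2 * (η / 6) + 1 / (N : ℝ) ^ 2) +
          (if q ∈ twoWallSpeedDevPairs y z N (η / 6) then wgt y z N q else 0)) := Finset.sum_le_sum hterm
    _ = (2 * (η / 6) + 1 / (N : ℝ) ^ 2) * stripZ₂ 1 N y z + ∑ q ∈ twoWallSpeedDevPairs y z N (η / 6), wgt y z N q := by
        rw [Finset.sum_add_distrib, ← Finset.sum_mul, stripZ₂_one_eq_sum_wgt, Finset.sum_ite_mem, mul_comm]
        congr 2
        exact Finset.inter_eq_right.2 (show twoWallSpeedDevPairs y z N (η / 6) ⊆ stripPairs 1 N from Finset.filter_subset _ _)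
    _ < (η / 3 + η / 3) * stripZ₂ 1 N y z + (η / 3) * stripZ₂ 1 N y z := by
        have hA' := (div_lt_iff₀ (hZ N)).1 hA
        have : (2 * (η / 6) + 1 / (N : ℝ) ^ 2) * stripZ₂ 1 N y z < (η / 3 + η / 3) * stripZ₂ 1 N y z := by
          apply mul_lt_mul_of_pos_right _ (hZ N); linarith
        linarith
    _ = η * stripZ₂ 1 N y z := by ring

end pairsY2

end Literature.Probability.RandomPlanarGeometry.SAW.HexBW
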